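/-
Copyright (c) 2026. All rights reserved.
Released under Apache 2.0 license as described in the file LICENSE.
Authors: HodgeCM publication cell (pub-hodgecm), SEAMS sprint strike worker `pv07`.
-/
import Literature.NumberTheory.Weil1964.AdelicMetaplecticRationalLift
import Literature.NumberTheory.Automorphic.AdelicPiSchwartzBruhatFourierInversion
import Literature.NumberTheory.Automorphic.AdelicSchwartzBruhatDirectSum
import HarnessLib

/-!
# The change of polarisation at the origin: `(ω(r_F γ) Ψ)(0) = ∫ Ψ(u,u) du` on the doubled symplectic space

Topic `NumberTheory/Weil1964`; namespace `Literature.NumberTheory.Weil1964`.  KERNEL MATHEMATICS ONLY: no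
`def … : Prop` record of a published theorem, no `axiom`, no proof hole; every tag is provenance for a kernel-checked
statement.  Origin: `pub-hodgecm` SEAMS sprint, site S4-10 kernel item (b): the evaluation constant `c = 1` in
`δ(φ₁ ⊗ φ̄₂)(0) = c · ⟨φ₁, φ₂⟩` for the change of polarisation `δ` of the doubling method
([Li1992, (10)–(13) pp. 181–182]; locally [HarrisKudlaSweet1996, (1.14)–(1.16) p. 952]).

SETTING.  `F` a number field, `𝔸 = 𝔸_F`, `ψ_F = adeleAddChar F`, `𝒮(𝔸^ι) = piSchwartzBruhat F ι`, the global
Schrödinger representation `ρ_T = adelicSchrodinger F ι T` of `H(W_T) = Heisenberg (polar β_T)`,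
`β_T(x, y) = x ⬝ (T y)` (`AdelicHeisenbergSchrodinger.lean`), the group of implementing pairs
`Mp_ψ(W_T)(𝔸) = adelicMp F ι T` with `π = MpPsi.proj`, `ω_ψ(g, M) = M`, its `Θ`-fixing subgroup `adelicMpTheta`
(`AdelicMetaplecticGroup.lean`), and Weil's homomorphic lift of the rational points
`r_F = ratThetaLiftContι F ι T hT : Sp_{2ι}(F) →* Mp_ψ(W_𝔸)ᶜᵒⁿᵗ` with `Θ ∘ ω(r_F γ) = Θ`
(`AdelicMetaplecticRationalLift.lean`, [Weil1964, Chap. III n° 41 Thm 6 p. 193]).  THE DOUBLED SPACE: for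
`T₀ ∈ GL_ι(F)` and `T = T₀ ⊗ 1` the index type is `ι ⊕ ι` and the Gram matrix is
`T₂ = doubledGram T = fromBlocks T 0 0 (-T)` (`𝕎 = W_T ⊕ W_{-T}`, [Li1992, p. 181]); its DIAGONAL LAGRANGIAN is
`W^Δ = {((a,a),(b,b))}` (`diagLagrangianPt`), isotropic for `x ⬝ (T₂ y)` (`diagLagrangianPt_isotropic`), and
`𝕐 = {0} × 𝔸^{ι⊕ι}` is the Lagrangian of the Schrödinger model `𝒮(𝔸^{ι⊕ι})`.  `D^ι = piFundamentalDomain F ι` is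
the Tate box (a fundamental domain for `F^ι` in `𝔸^ι`), `ν` any additive Haar measure on `𝔸^ι`.

WHAT IS HERE (all proved):
* §1 (R1) THE CONSTANT TERM OF THE THETA KERNEL ALONG `𝕐`: for a rational invertible Gram matrix `T = T₀ ⊗ 1`,
  `∫_{D^ι} Θ(ρ_T((x,y),0) Φ) dν(y) = ν(D^ι) · Φ(x)` (`setIntegral_thetaDist_adelicSchrodinger_ofVec`; orthogonality
  of `y ↦ ψ_F(⟨ξ, T y⟩)` over the Tate box, `tsum`/integral exchange by the Schwartz–Bruhat majorant).
* §2 (R5)–(R6) THE DIAGONAL LAGRANGIAN: `∫_{D^ι} Θ(ρ_{T₂}(((a,a),(b,b)),0) Ψ) dν(b) = ν(D^ι) Σ_{ξ ∈ F^ι} Ψ(ξ+a, ξ+a)`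
  (`setIntegral_thetaDist_diag`) and `∫_{D^ι} Σ_ξ Ψ(ξ+a, ξ+a) dν(a) = ∫_{𝔸^ι} Ψ(u,u) dν(u)` (`setIntegral_tsum_diag`,
  unfolding); `u ↦ Ψ(u,u) ∈ 𝒮(𝔸^ι)` (`diag_mem_piSchwartzBruhat`).
* §3 (R4) RATIONAL LINEAR CHANGES OF VARIABLES ON THE TATE DOMAIN: for `A₀ ∈ GL_κ(F)` and a continuous
  `F^κ`-periodic `H`, `∫_{D^κ} H((A₀ ⊗ 1) y) dν(y) = ∫_{D^κ} H dν` (`setIntegral_comp_ratLinCLE_eq`: `A₀ ⊗ 1` normalises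
  the lattice `F^κ`, so `(A₀ ⊗ 1)(D^κ)` is again a fundamental domain (`IsAddFundamentalDomain.image_of_equiv`), and
  `ν ∘ (A₀ ⊗ 1)⁻¹ = ν` by Haar uniqueness with the scalar pinned on the two fundamental domains — the adelic
  "product formula" `|det A₀|_𝔸 = 1` in measure-theoretic form, `map_ratLinCLE_eq`).
* §4 THE DIAGONAL THETA LIFT `z = (a,b) ↦ Θ(ρ_{T₂}(((a,a),(b,b)),0) Ψ)` (`diagLagrangianTheta`): its `ξ`-series, its
  `F^{ι⊕ι}`-periodicity (`diagLagrangianTheta_add_ratPt`) and continuity (M-test on compacta); the product measure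
  `(ν ⊗ ν)` on `𝔸^{ι⊕ι}` (`sumElimMeasure`), `(ν ⊗ ν)(D^{ι⊕ι}) = ν(D^ι)²`, Fubini over `D^{ι⊕ι} = D^ι × D^ι`.
* §5 (R2) IMPLEMENTERS INTERTWINE: `ρ(h)(M Ψ) = M(ρ(s⁻¹·h) Ψ)` for `(g, M) ∈ Mp_ψ`, `s = ofSymplectic g`
  (`adelicSchrodinger_toOp`), and WEIL'S COCYCLE VANISHES ON AN ISOTROPIC VECTOR MAPPED INTO `𝕐`:
  `(ofSymplectic g)⁻¹ · ((0,y),0) = (l, 0)` when `g l = (0,y)` and `l₁ ⬝ T l₂ = 0` (`ofSymplectic_inv_act_ofVec`).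
* §6 **THE CORE THEOREM** `measure_mul_toOp_apply_zero_eq_integral_diag`: for EVERY `Θ`-fixing pair
  `p = (g, M) ∈ Mp_ψ(𝕎_𝔸)^Θ` whose projection carries `W^Δ` onto `𝕐` through a rational parametrisation
  `A₀ ∈ GL_{ι⊕ι}(F)` (`g(((a,a),(b,b))) = (0, y)` whenever `(a,b) = (A₀ ⊗ 1) y`), and every `Ψ ∈ 𝒮(𝔸^{ι⊕ι})`,
  **`ν(D^ι) · (M Ψ)(0) = ∫_{𝔸^ι} Ψ(u,u) dν(u)`**.  Proof: `ν(D)² (MΨ)(0) = ∫_{D^{ι⊕ι}} Θ(ρ_{T₂}((0,y),0)(MΨ)) d(ν⊗ν)`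
  (R1 on the doubled space); the integrand is `Θ(M ρ(s⁻¹(0,y))Ψ) = Θ(ρ_{T₂}((A₀⊗1)y ↦ W^Δ)Ψ)` (R2, the cocycle
  vanishing, `Θ ∘ M = Θ`) `= diagLagrangianTheta Ψ ((A₀ ⊗ 1) y)`; drop `A₀ ⊗ 1` (R4); Fubini, (R5), (R6).
* §7 FOR WEIL'S `r_F(γ)`, `γ ∈ Sp_{2(ι⊕ι)}(F)`: `ν(D^ι) · (ω(r_F γ) Ψ)(0) = ∫ Ψ(u,u) dν`
  (`measure_mul_omega_ratThetaLiftContι_apply_zero`); with the Tamagawa normalisation `ν(D^ι) = 1`: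
  **`(ω(r_F γ) Ψ)(0) = ∫_{𝔸^ι} Ψ(u,u) dν(u)`** (`omega_ratThetaLiftContι_apply_zero`), the box forms
  `(ω(r_F γ)(φ₁ ⊠ φ₂))(0) = ∫ φ₁ φ₂ dν` (`omega_ratThetaLiftContι_tensorToSum_apply_zero`); with `φ₂ ↦ φ̄₂`
  (`piSchwartzBruhatConj F ι φ₂` of `AdelicSchrodingerConj.lean`, pointwise `conj ∘ φ₂`) this reads
  **`(ω(r_F γ)(φ₁ ⊠ φ̄₂))(0) = ∫ φ₁ φ̄₂ dν = ⟨φ₁, φ₂⟩`** — the constant of [Li1992, (13)] is `c = 1` for Weil's canonical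
  `r_F(γ)` and Tamagawa `du`, for every `γ` carrying `W^Δ` onto `𝕐` rationally (in particular for the element `δ` of
  [Li1992, p. 181], [HarrisKudlaSweet1996, (1.3) p. 950]).
* §8 FROM `γ(W^Δ) ⊆ 𝕐` TO THE PARAMETRISATION (linear algebra over `F`, section `Lagrangian`): in Darboux
  coordinates a point of `W^Δ` is `((M₁ ⊗ 1) c, (M₂ ⊗ 1) c)` with rational `M₁, M₂`, so
  `r(γ)(diag c) = ((P₀ ⊗ 1) c, T₂⁻¹ (Q₀ ⊗ 1) c)` (`ratSpι_diagLagrangianPt`); `r(γ)(W^Δ(𝔸)) ⊆ 𝕐` gives `P₀ = 0`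
  (`diagFstBlock_eq_zero`), then `Q₀ ∈ GL(F)` (`isUnit_diagSndBlock`) and `A₀ = Q₀⁻¹ (T₀ ⊕ (-T₀))` parametrises
  (`exists_ratParam_of_fst_ratSpι_diag_eq_zero`; in particular `⊆` forces `r(γ)(W^Δ) = 𝕐`).  Hence the `⊆`-FORMS
  `measure_mul_omega_ratThetaLiftContι_apply_zero_of_subset`, `omega_ratThetaLiftContι_apply_zero_of_subset` and
  **`omega_ratThetaLiftContι_tensorToSum_apply_zero_of_subset`: for every `γ ∈ Sp_{2(ι⊕ι)}(F)` with
  `r_F(γ)(W^Δ(𝔸)) ⊆ 𝕐(𝔸)` and Tamagawa `ν`, `(ω(r_F γ)(φ₁ ⊠ φ₂))(0) = ∫ φ₁ φ₂ dν`** (the sprint's typed statement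
  of kernel item (b)).

WHAT IS NOT HERE: (i) the description of `ω(r_F δ)` as a partial Fourier transform ([Li1992, (12)]) — not needed
for the value at `0`; (ii) local statements ([HarrisKudlaSweet1996, (1.16)] is local; here everything is
adelic/global); (iii) the corollary with `φ̄₂ = piSchwartzBruhatConj F ι φ₂` spelled out (a `rfl`-rewrite of the box
form by `piSchwartzBruhatConj_apply`, left to the file importing `AdelicSchrodingerConj.lean`).

## References

* [Li1992] J.-S. Li, *Non-vanishing theorems for the cohomology of certain arithmetic quotients*, J. reine angew.
  Math. 428 (1992) 177–217, (10)–(15) pp. 181–182 (the doubled space `𝕎 = W ⊕ W⁻`, `W^Δ`, `δ`, `c = 1` in (13)).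
* [HarrisKudlaSweet1996] M. Harris, S. Kudla, W. J. Sweet, *Theta dichotomy for unitary groups*, J. Amer. Math.
  Soc. 9 (1996) 941–1004, (1.1)–(1.3) p. 950, (1.14)–(1.16) p. 952.
* [Weil1964] A. Weil, *Sur certains groupes d'opérateurs unitaires*, Acta Math. 111 (1964) 143–211, Chap. I n° 4
  p. 149, n° 5 pp. 150–151 (the cocycle of `ofSymplectic`), Chap. III n° 41 Thm 6 p. 193 (`r_F`).
* [GelbartRogawski1991] S. Gelbart, J. Rogawski, *L-functions and Fourier–Jacobi coefficients for the unitary group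
  U(3)*, Invent. math. 105 (1991) 445–472, §3.1 p. 454 (`ω_ψ(g, M) = M`).
-/

noncomputable section

open NumberField NumberField.mixedEmbedding MeasureTheory MeasureTheory.Measure IsDedekindDomain
open Literature.NumberTheory.Automorphic Literature.RepresentationTheory.HeisenbergGroup
open scoped Matrix Classical

namespace Literature.NumberTheory.Weil1964

attribute [local instance] secondCountableTopology_adeleRing locallyCompactSpace_adeleRing' t2Space_adeleRing

section Pullback

variable {F : Type} [Field F] [NumberField F] {ι ι' : Type} [Fintype ι] [Fintype ι']

/-- Factorizable Schwartz–Bruhat functions pull back along `w ↦ w ∘ e` for `e : ι → ι'` surjective. [folklore] -/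
theorem IsFactorizablePiSchwartzBruhat.comp_surjective {Φ : (ι → AdeleRing (𝓞 F) F) → ℂ}
    (h : IsFactorizablePiSchwartzBruhat F ι Φ) {e : ι → ι'} (he : Function.Surjective e) :
    IsFactorizablePiSchwartzBruhat F ι' fun w => Φ (w ∘ e) := by
  obtain ⟨Φinf, Φfin, hfin, rfl⟩ := h
  -- archimedean factor: pull back along the injective linear map `a ↦ a ∘ e`
  let L : (ι' → mixedSpace F) →L[ℝ] (ι → mixedSpace F) :=
    ContinuousLinearMap.pi fun i => ContinuousLinearMap.proj (e i)
  have hLapply : ∀ a, L a = a ∘ e := fun a => rfl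
  have hLinj : Function.Injective L := by
    intro a b hab
    funext j
    obtain ⟨i, rfl⟩ := he j
    have := congr_fun (show a ∘ e = b ∘ e by rw [← hLapply, ← hLapply, hab]) i
    exact this
  obtain ⟨k, -, hk⟩ := L.toLinearMap.exists_antilipschitzWith (LinearMap.ker_eq_bot.2 hLinj)
  -- a section of `e` for the compact-support argument
  let s : ι' → ι := Function.surjInv he
  have hs : ∀ j, e (s j) = j := Function.surjInv_eq he
  refine ⟨SchwartzMap.compCLMOfAntilipschitz ℂ L.hasTemperateGrowth hk Φinf, fun b => Φfin (b ∘ e), ?_, ?_⟩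
  · obtain ⟨hlc, hcs⟩ := (mem_schwartzBruhat_iff).1 hfin
    refine (mem_schwartzBruhat_iff).2 ⟨hlc.comp_continuous (continuous_pi fun i => continuous_apply (e i)), ?_⟩
    refine HasCompactSupport.intro ((hcs.isCompact).image (continuous_pi fun j => continuous_apply (s j) :
      Continuous fun a : ι → FiniteAdeleRing (𝓞 F) F => fun j => a (s j))) fun b hb => ?_
    by_contra hne
    refine hb ⟨b ∘ e, subset_tsupport _ (Function.mem_support.2 hne), ?_⟩
    funext j
    change (b ∘ e) (s j) = b j
    rw [Function.comp_apply, hs]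
  · funext w
    rfl

/-- **`𝒮(𝔸_F^ι)` is stable under coordinate duplication** `w ↦ w ∘ e`, `e` surjective. [folklore] -/
theorem comp_surjective_mem_piSchwartzBruhat {Φ : (ι → AdeleRing (𝓞 F) F) → ℂ}
    (hΦ : Φ ∈ piSchwartzBruhat F ι) {e : ι → ι'} (he : Function.Surjective e) :
    (fun w : ι' → AdeleRing (𝓞 F) F => Φ (w ∘ e)) ∈ piSchwartzBruhat F ι' := by
  induction hΦ using Submodule.span_induction with
  | mem Φ h => exact mem_piSchwartzBruhat (IsFactorizablePiSchwartzBruhat.comp_surjective h he)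
  | zero => exact zero_mem _
  | add Φ Ψ _ _ ihΦ ihΨ => exact add_mem ihΦ ihΨ
  | smul c Φ _ ih => exact Submodule.smul_mem _ c ih

/-- The diagonal restriction `u ↦ Ψ(u, u)` of `Ψ ∈ 𝒮(𝔸^{ι ⊕ ι})` lies in `𝒮(𝔸^ι)`. [folklore] -/
theorem diag_mem_piSchwartzBruhat {Ψ : (ι ⊕ ι → AdeleRing (𝓞 F) F) → ℂ}
    (hΨ : Ψ ∈ piSchwartzBruhat F (ι ⊕ ι)) :
    (fun u : ι → AdeleRing (𝓞 F) F => Ψ (Sum.elim u u)) ∈ piSchwartzBruhat F ι := by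
  have h := comp_surjective_mem_piSchwartzBruhat hΨ (e := Sum.elim id id)
    (fun j => ⟨Sum.inl j, rfl⟩)
  convert h using 2 with u
  congr 1
  funext i
  cases i <;> rfl

end Pullback

section Averaging

variable {F : Type} [Field F] [NumberField F] {ι κ : Type} [Fintype ι] [Fintype κ]
  [MeasurableSpace (AdeleRing (𝓞 F) F)] [BorelSpace (AdeleRing (𝓞 F) F)]
  (ν : Measure (ι → AdeleRing (𝓞 F) F)) [ν.IsAddHaarMeasure]

/-- **Averaging a character series over the Tate domain keeps the zero-frequency terms**:
`∫_{D^ι} Σ_ξ Φ(ξ + x) ψ(Σ_j c(ξ)_j y_j) dν(y) = ν(D^ι) Σ_{ξ : c(ξ) = 0} Φ(ξ + x)`. [folklore] -/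
theorem setIntegral_tsum_mul_adeleAddChar (Φ : piSchwartzBruhat F κ) (x : κ → AdeleRing (𝓞 F) F)
    (c : (κ → F) → (ι → F)) :
    ∫ y in piFundamentalDomain F ι, ∑' ξ : κ → F,
        (Φ : (κ → AdeleRing (𝓞 F) F) → ℂ) (ratPt F κ ξ + x) *
          ((adeleAddChar F (∑ j, algebraMap F (AdeleRing (𝓞 F) F) (c ξ j) * y j) : Circle) : ℂ) ∂ν =
      ((ν (piFundamentalDomain F ι)).toReal : ℂ) *
        ∑' ξ : κ → F, if c ξ = 0 then (Φ : (κ → AdeleRing (𝓞 F) F) → ℂ) (ratPt F κ ξ + x) else 0 := by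
  classical
  haveI := t2Space_adeleRing F
  haveI : Countable F := NumberField.countable' (K := F)
  set G : (κ → F) → (ι → AdeleRing (𝓞 F) F) → ℂ := fun ξ y =>
    (Φ : (κ → AdeleRing (𝓞 F) F) → ℂ) (ratPt F κ ξ + x) *
      ((adeleAddChar F (∑ j, algebraMap F (AdeleRing (𝓞 F) F) (c ξ j) * y j) : Circle) : ℂ) with hG
  have hcont : ∀ ξ, Continuous (G ξ) := fun ξ =>
    continuous_const.mul (continuous_subtype_val.comp ((continuous_adeleAddChar F).comp
      (continuous_finsetSum _ fun i _ => continuous_const.mul (continuous_apply i))))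
  have hint : ∀ ξ, IntegrableOn (G ξ) (piFundamentalDomain F ι) ν := fun ξ =>
    ((hcont ξ).continuousOn.integrableOn_compact (isCompact_closure_piFundamentalDomain F ι)).mono_set
      subset_closure
  have hnorm : ∀ ξ y, ‖G ξ y‖ = ‖(Φ : (κ → AdeleRing (𝓞 F) F) → ℂ) (ratPt F κ ξ + x)‖ := fun ξ y => by
    rw [hG, norm_mul, Circle.norm_coe, mul_one]
  have hsum : Summable fun ξ => ∫ y in piFundamentalDomain F ι, ‖G ξ y‖ ∂ν := by
    simp_rw [hnorm, setIntegral_const, smul_eq_mul]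
    exact (summable_norm_apply_ratPt_add Φ.2 x).mul_left _
  change ∫ y in piFundamentalDomain F ι, ∑' ξ, G ξ y ∂ν = _
  rw [← integral_tsum_of_summable_integral_norm hint hsum]
  have hterm : ∀ ξ, ∫ y in piFundamentalDomain F ι, G ξ y ∂ν =
      (Φ : (κ → AdeleRing (𝓞 F) F) → ℂ) (ratPt F κ ξ + x) *
        (if c ξ = 0 then ((ν (piFundamentalDomain F ι)).toReal : ℂ) else 0) := fun ξ => by
    rw [hG]
    dsimp only
    rw [integral_const_mul, setIntegral_adeleAddChar_piFundamentalDomain]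
  simp_rw [hterm]
  rw [← tsum_mul_left]
  refine tsum_congr fun ξ => ?_
  split_ifs <;> ring

end Averaging

section ConstantTerm

variable {F : Type} [Field F] [NumberField F] {ι : Type} [Fintype ι] [DecidableEq ι]

omit [DecidableEq ι] in
/-- The pairing `⟨ξ, T y⟩` for a rational matrix `T = T₀ ⊗ 1` is the rational character pairing of `ξ T₀`
with `y`. [folklore] -/
theorem piPairing_map_mulVec (T₀ : Matrix ι ι F) (ξ : ι → F) (y : ι → AdeleRing (𝓞 F) F) :
    piPairing F ξ ((T₀.map (algebraMap F (AdeleRing (𝓞 F) F))) *ᵥ y) =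
      ∑ i, algebraMap F (AdeleRing (𝓞 F) F) ((ξ ᵥ* T₀) i) * y i := by
  simp only [piPairing_apply, Matrix.mulVec, dotProduct, Matrix.map_apply, Matrix.vecMul,
    Finset.mul_sum, _root_.map_sum, map_mul, Finset.sum_mul]
  rw [Finset.sum_comm]
  refine Finset.sum_congr rfl fun j _ => Finset.sum_congr rfl fun i _ => ?_
  ring

variable [MeasurableSpace (AdeleRing (𝓞 F) F)] [BorelSpace (AdeleRing (𝓞 F) F)]
  (ν : Measure (ι → AdeleRing (𝓞 F) F)) [ν.IsAddHaarMeasure]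

/-- **(R1) Constant-term formula.** `∫_{D^ι} Θ(ρ_T((x,y),0)Φ) dν(y) = ν(D^ι) Φ(x)` for rational invertible
`T = T₀ ⊗ 1`. [cite: Li1992, (11)–(12) p. 182] [folklore] -/
theorem setIntegral_thetaDist_adelicSchrodinger_ofVec (T₀ : Matrix ι ι F) (hT₀ : IsUnit T₀)
    (x : ι → AdeleRing (𝓞 F) F) (Φ : piSchwartzBruhat F ι) :
    ∫ y in piFundamentalDomain F ι,
        (thetaDist F ι (adelicSchrodinger F ι (T₀.map (algebraMap F (AdeleRing (𝓞 F) F)))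
          (Heisenberg.ofVec (polar (adelicForm F ι (T₀.map (algebraMap F (AdeleRing (𝓞 F) F))))) (x, y)) Φ :
          (ι → AdeleRing (𝓞 F) F) → ℂ)) ∂ν =
      ((ν (piFundamentalDomain F ι)).toReal : ℂ) * (Φ : (ι → AdeleRing (𝓞 F) F) → ℂ) x := by
  classical
  simp_rw [thetaDist_adelicSchrodinger_ofVec, piAdeleChar_apply, piPairing_map_mulVec]
  rw [setIntegral_tsum_mul_adeleAddChar ν Φ x (fun ξ => ξ ᵥ* T₀)]
  have hiff : ∀ ξ : ι → F, ξ ᵥ* T₀ = 0 ↔ ξ = 0 := fun ξ => by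
    constructor
    · intro h
      exact Matrix.vecMul_injective_iff_isUnit.mpr hT₀ (h.trans (Matrix.zero_vecMul T₀).symm)
    · rintro rfl
      exact Matrix.zero_vecMul T₀
  simp_rw [hiff]
  rw [tsum_eq_single 0 fun ξ hξ => by simp [hξ]]
  simp

end ConstantTerm

section Diagonal

variable {F : Type} [Field F] [NumberField F] {ι : Type} [Fintype ι] [DecidableEq ι]

/-- Gram matrix of the doubled space `W_T ⊕ W_{-T}`.
[cite: Li1992, p. 181] [cite: HarrisKudlaSweet1996, (1.1)–(1.3) p. 950] -/
abbrev doubledGram (T : Matrix ι ι (AdeleRing (𝓞 F) F)) : Matrix (ι ⊕ ι) (ι ⊕ ι) (AdeleRing (𝓞 F) F) :=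
  Matrix.fromBlocks T 0 0 (-T)

omit [DecidableEq ι] in
/-- The pairing of a rational frequency `ξ = (ξ₁, ξ₂)` with `T₂(b, b) = (T b, -T b)`, `T = T₀ ⊗ 1`:
`⟨ξ, T₂(b,b)⟩ = Σ_j ((ξ₁ - ξ₂) T₀)_j b_j`. [folklore] -/
theorem piPairing_doubledGram_mulVec_diag (T₀ : Matrix ι ι F) (ξ : ι ⊕ ι → F) (b : ι → AdeleRing (𝓞 F) F) :
    piPairing F ξ (doubledGram (T₀.map (algebraMap F (AdeleRing (𝓞 F) F))) *ᵥ Sum.elim b b) =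
      ∑ j, algebraMap F (AdeleRing (𝓞 F) F) ((((ξ ∘ Sum.inl) - (ξ ∘ Sum.inr)) ᵥ* T₀) j) * b j := by
  simp only [doubledGram, Matrix.fromBlocks_mulVec, Sum.elim_comp_inl, Sum.elim_comp_inr, Matrix.zero_mulVec,
    add_zero, zero_add, Matrix.neg_mulVec]
  rw [← piPairing_map_mulVec]
  simp only [piPairing_apply, Fintype.sum_sum_type, Sum.elim_inl, Sum.elim_inr, Pi.sub_apply,
    Function.comp_apply, map_sub, Pi.neg_apply, sub_mul, Finset.sum_sub_distrib, mul_neg,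
    Finset.sum_neg_distrib]
  ring

variable [MeasurableSpace (AdeleRing (𝓞 F) F)] [BorelSpace (AdeleRing (𝓞 F) F)]
  (ν : Measure (ι → AdeleRing (𝓞 F) F)) [ν.IsAddHaarMeasure]

/-- **(R5) The diagonal Lagrangian.** For `Ψ ∈ 𝒮(𝔸^{ι⊕ι})` and the doubled Gram matrix `T₂ = T ⊕ (-T)`,
`T = T₀ ⊗ 1` rational invertible:
`∫_{D^ι} Θ(ρ_{T₂}(((a,a),(b,b)),0)Ψ) dν(b) = ν(D^ι) Σ_{η ∈ F^ι} Ψ((η,η) + (a,a))`. [folklore] -/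
theorem setIntegral_thetaDist_diag (T₀ : Matrix ι ι F) (hT₀ : IsUnit T₀)
    (a : ι → AdeleRing (𝓞 F) F) (Ψ : piSchwartzBruhat F (ι ⊕ ι)) :
    ∫ b in piFundamentalDomain F ι,
        (thetaDist F (ι ⊕ ι) (adelicSchrodinger F (ι ⊕ ι) (doubledGram (T₀.map (algebraMap F (AdeleRing (𝓞 F) F))))
          (Heisenberg.ofVec (polar (adelicForm F (ι ⊕ ι) (doubledGram (T₀.map (algebraMap F (AdeleRing (𝓞 F) F))))))
            (Sum.elim a a, Sum.elim b b)) Ψ : (ι ⊕ ι → AdeleRing (𝓞 F) F) → ℂ)) ∂ν =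
      ((ν (piFundamentalDomain F ι)).toReal : ℂ) *
        ∑' η : ι → F, (Ψ : (ι ⊕ ι → AdeleRing (𝓞 F) F) → ℂ) (ratPt F (ι ⊕ ι) (Sum.elim η η) + Sum.elim a a) := by
  classical
  simp_rw [thetaDist_adelicSchrodinger_ofVec, piAdeleChar_apply, piPairing_doubledGram_mulVec_diag]
  rw [setIntegral_tsum_mul_adeleAddChar ν Ψ (Sum.elim a a) (fun ξ => ((ξ ∘ Sum.inl) - (ξ ∘ Sum.inr)) ᵥ* T₀)]
  congr 1
  have hiff : ∀ ξ : ι ⊕ ι → F, ((ξ ∘ Sum.inl) - (ξ ∘ Sum.inr)) ᵥ* T₀ = 0 ↔ ξ ∘ Sum.inl = ξ ∘ Sum.inr :=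
    fun ξ => by
    constructor
    · intro h
      exact sub_eq_zero.1 (Matrix.vecMul_injective_iff_isUnit.mpr hT₀ (h.trans (Matrix.zero_vecMul T₀).symm))
    · intro h
      rw [h, sub_self, Matrix.zero_vecMul]
  simp_rw [hiff]
  symm
  rw [← (show Function.Injective (fun η : ι → F => Sum.elim η η) from fun η η' h => by
      funext i; simpa using congr_fun h (Sum.inl i)).tsum_eq (f := fun ξ : ι ⊕ ι → F =>
      if ξ ∘ Sum.inl = ξ ∘ Sum.inr then (Ψ : (ι ⊕ ι → AdeleRing (𝓞 F) F) → ℂ) (ratPt F (ι ⊕ ι) ξ + Sum.elim a a)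
      else 0)]
  · refine tsum_congr fun η => ?_
    simp only [Sum.elim_comp_inl, Sum.elim_comp_inr, if_true]
  · intro ξ hξ
    rw [Function.mem_support] at hξ
    refine ⟨ξ ∘ Sum.inl, ?_⟩
    by_cases h : ξ ∘ Sum.inl = ξ ∘ Sum.inr
    · funext i
      cases i with
      | inl i => rfl
      | inr i => exact congr_fun h i
    · exact absurd (if_neg h) hξ

omit [DecidableEq ι] in
/-- **(R6) Unfolding the diagonal.** `∫_{D^ι} Σ_η Ψ((η,η) + (a,a)) dν(a) = ∫_{𝔸^ι} Ψ(u,u) dν(u)`. [folklore] -/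
theorem setIntegral_tsum_diag (Ψ : piSchwartzBruhat F (ι ⊕ ι)) :
    ∫ a in piFundamentalDomain F ι,
        ∑' η : ι → F, (Ψ : (ι ⊕ ι → AdeleRing (𝓞 F) F) → ℂ) (ratPt F (ι ⊕ ι) (Sum.elim η η) + Sum.elim a a) ∂ν =
      ∫ u, (Ψ : (ι ⊕ ι → AdeleRing (𝓞 F) F) → ℂ) (Sum.elim u u) ∂ν := by
  have hdiag := diag_mem_piSchwartzBruhat Ψ.2
  rw [integral_eq_setIntegral_piFundamentalDomain_tsum ν (integrable_of_mem_piSchwartzBruhat hdiag)]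
  refine setIntegral_congr_fun (measurableSet_piFundamentalDomain F ι) fun a _ => ?_
  refine tsum_congr fun η => ?_
  exact congrArg _ (funext fun i => by cases i <;> simp [ratPt_apply, add_comm])

end Diagonal

section RatLinear

variable {F : Type} [Field F] [NumberField F] {κ : Type} [Fintype κ] [DecidableEq κ]

omit [DecidableEq κ] in
/-- `(A ⊗ 1)((B ⊗ 1) v) = ((A B) ⊗ 1) v`. [folklore] -/
theorem map_mulVec_map_mulVec (A B : Matrix κ κ F) (v : κ → AdeleRing (𝓞 F) F) :
    A.map (algebraMap F (AdeleRing (𝓞 F) F)) *ᵥ (B.map (algebraMap F (AdeleRing (𝓞 F) F)) *ᵥ v) =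
      (A * B).map (algebraMap F (AdeleRing (𝓞 F) F)) *ᵥ v := by
  rw [Matrix.mulVec_mulVec, ← Matrix.map_mul]

/-- `(1 ⊗ 1) v = v`. [folklore] -/
theorem one_map_mulVec (v : κ → AdeleRing (𝓞 F) F) :
    (1 : Matrix κ κ F).map (algebraMap F (AdeleRing (𝓞 F) F)) *ᵥ v = v := by
  rw [Matrix.map_one _ (map_zero _) (map_one _), Matrix.one_mulVec]

omit [DecidableEq κ] in
/-- `(A₀ ⊗ 1)` maps principal points to principal points: `(A₀ ⊗ 1) ζ = A₀ ζ`. [folklore] -/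
theorem map_mulVec_ratPt (A₀ : Matrix κ κ F) (ζ : κ → F) :
    A₀.map (algebraMap F (AdeleRing (𝓞 F) F)) *ᵥ ratPt F κ ζ = ratPt F κ (A₀ *ᵥ ζ) := by
  funext i
  simp [Matrix.mulVec, dotProduct, _root_.map_sum, map_mul]

omit [DecidableEq κ] in
/-- `(A₀ ⊗ 1)` preserves the lattice `F^κ`. [folklore] -/
theorem map_mulVec_mem_piPrincipalSubgroup (A₀ : Matrix κ κ F) {v : κ → AdeleRing (𝓞 F) F}
    (hv : v ∈ piPrincipalSubgroup F κ) :
    A₀.map (algebraMap F (AdeleRing (𝓞 F) F)) *ᵥ v ∈ piPrincipalSubgroup F κ := by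
  obtain ⟨ζ, rfl⟩ := exists_ratPt_eq_of_mem_piPrincipalSubgroup hv
  rw [map_mulVec_ratPt]
  exact ratPt_mem_piPrincipalSubgroup (F := F) _

/-- The continuous linear automorphism `y ↦ (A₀ ⊗ 1) y` of `𝔸_F^κ`, `A₀ ∈ GL_κ(F)`. [folklore] -/
def ratLinCLE (A₀ : Matrix κ κ F) (hA₀ : IsUnit A₀) :
    (κ → AdeleRing (𝓞 F) F) ≃L[AdeleRing (𝓞 F) F] (κ → AdeleRing (𝓞 F) F) where
  toFun v := A₀.map (algebraMap F (AdeleRing (𝓞 F) F)) *ᵥ v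
  invFun v := A₀⁻¹.map (algebraMap F (AdeleRing (𝓞 F) F)) *ᵥ v
  map_add' := Matrix.mulVec_add _
  map_smul' c v := by simp [Matrix.mulVec_smul]
  left_inv v := by
    show A₀⁻¹.map _ *ᵥ (A₀.map _ *ᵥ v) = v
    rw [map_mulVec_map_mulVec, Matrix.nonsing_inv_mul _ ((Matrix.isUnit_iff_isUnit_det _).1 hA₀),
      one_map_mulVec]
  right_inv v := by
    show A₀.map _ *ᵥ (A₀⁻¹.map _ *ᵥ v) = v
    rw [map_mulVec_map_mulVec, Matrix.mul_nonsing_inv _ ((Matrix.isUnit_iff_isUnit_det _).1 hA₀),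
      one_map_mulVec]
  continuous_toFun := continuous_const.matrix_mulVec continuous_id
  continuous_invFun := continuous_const.matrix_mulVec continuous_id

/-- formula for `ratLinCLE`. [folklore] -/
@[simp] theorem ratLinCLE_apply (A₀ : Matrix κ κ F) (hA₀ : IsUnit A₀) (v : κ → AdeleRing (𝓞 F) F) :
    ratLinCLE A₀ hA₀ v = A₀.map (algebraMap F (AdeleRing (𝓞 F) F)) *ᵥ v := rfl

/-- formula for the inverse of `ratLinCLE`. [folklore] -/
@[simp] theorem ratLinCLE_symm_apply (A₀ : Matrix κ κ F) (hA₀ : IsUnit A₀)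
    (v : κ → AdeleRing (𝓞 F) F) :
    (ratLinCLE A₀ hA₀).symm v = A₀⁻¹.map (algebraMap F (AdeleRing (𝓞 F) F)) *ᵥ v := rfl

/-- The bijection of `(F^κ)ᵒᵖ` induced by `(A₀ ⊗ 1)⁻¹` (used to transport the fundamental domain). [folklore] -/
def ratLinOpEquiv (A₀ : Matrix κ κ F) (hA₀ : IsUnit A₀) :
    (piPrincipalSubgroup F κ).op ≃ (piPrincipalSubgroup F κ).op where
  toFun g := ⟨AddOpposite.op ((ratLinCLE A₀ hA₀).symm (AddOpposite.unop (g : (κ → AdeleRing (𝓞 F) F)ᵃᵒᵖ))),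
    AddSubgroup.mem_op.2 (by
      simpa using map_mulVec_mem_piPrincipalSubgroup A₀⁻¹ (AddSubgroup.mem_op.1 g.2))⟩
  invFun g := ⟨AddOpposite.op ((ratLinCLE A₀ hA₀) (AddOpposite.unop (g : (κ → AdeleRing (𝓞 F) F)ᵃᵒᵖ))),
    AddSubgroup.mem_op.2 (by
      simpa using map_mulVec_mem_piPrincipalSubgroup A₀ (AddSubgroup.mem_op.1 g.2))⟩
  left_inv g := by
    apply Subtype.ext
    simp only [AddOpposite.unop_op, ContinuousLinearEquiv.apply_symm_apply, AddOpposite.op_unop]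
  right_inv g := by
    apply Subtype.ext
    simp only [AddOpposite.unop_op, ContinuousLinearEquiv.symm_apply_apply, AddOpposite.op_unop]

variable [MeasurableSpace (AdeleRing (𝓞 F) F)] [BorelSpace (AdeleRing (𝓞 F) F)]
  (ν : Measure (κ → AdeleRing (𝓞 F) F)) [ν.IsAddHaarMeasure]

/-- A continuous linear automorphism of `𝔸^κ` is quasi-measure-preserving for Haar measure. [folklore] -/
theorem quasiMeasurePreserving_ratLinCLE (A₀ : Matrix κ κ F) (hA₀ : IsUnit A₀) :
    QuasiMeasurePreserving (ratLinCLE A₀ hA₀) ν ν := by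
  refine ⟨(ratLinCLE A₀ hA₀).continuous.measurable, ?_⟩
  rw [isAddLeftInvariant_eq_smul (ν.map (ratLinCLE A₀ hA₀)) ν]
  exact smul_absolutelyContinuous

/-- The image `(A₀ ⊗ 1) D^κ` of the Tate domain is again a fundamental domain for `F^κ`. [folklore] -/
theorem isAddFundamentalDomain_image_ratLinCLE (A₀ : Matrix κ κ F) (hA₀ : IsUnit A₀) :
    IsAddFundamentalDomain (piPrincipalSubgroup F κ).op
      ((ratLinCLE A₀ hA₀) '' piFundamentalDomain F κ) ν := by
  have hD := isAddFundamentalDomain_op_piFundamentalDomain F κ ν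
  have hq : QuasiMeasurePreserving (ratLinCLE A₀ hA₀).symm ν ν := by
    refine ⟨(ratLinCLE A₀ hA₀).symm.continuous.measurable, ?_⟩
    rw [isAddLeftInvariant_eq_smul (ν.map (ratLinCLE A₀ hA₀).symm) ν]
    exact smul_absolutelyContinuous
  refine hD.image_of_equiv (ratLinCLE A₀ hA₀).toEquiv hq (ratLinOpEquiv A₀ hA₀) ?_
  intro g x
  show (ratLinCLE A₀ hA₀) ((ratLinOpEquiv A₀ hA₀ g) +ᵥ x) = g +ᵥ (ratLinCLE A₀ hA₀) x
  rw [AddSubgroup.vadd_def, AddSubgroup.vadd_def, AddOpposite.vadd_eq_add_unop, AddOpposite.vadd_eq_add_unop]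
  show (ratLinCLE A₀ hA₀) (x + (ratLinCLE A₀ hA₀).symm (AddOpposite.unop (g : (κ → AdeleRing (𝓞 F) F)ᵃᵒᵖ))) = _
  rw [map_add, ContinuousLinearEquiv.apply_symm_apply]

/-- **Rational linear automorphisms preserve adelic Haar measure**: `(A₀ ⊗ 1)_* ν = ν` for
`A₀ ∈ GL_κ(F)` (the lattice `F^κ` is preserved, so the covolume is, and Haar measure is unique). [folklore] -/
theorem map_ratLinCLE_eq (A₀ : Matrix κ κ F) (hA₀ : IsUnit A₀) : ν.map (ratLinCLE A₀ hA₀) = ν := by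
  haveI : Countable F := NumberField.countable' (K := F)
  set A := ratLinCLE A₀ hA₀ with hA
  have hD := isAddFundamentalDomain_op_piFundamentalDomain F κ ν
  have hAD := isAddFundamentalDomain_image_ratLinCLE ν A₀ hA₀
  have hc := isAddLeftInvariant_eq_smul (ν.map A) ν
  -- evaluate both sides on the fundamental domain `A '' D`
  have hmeasD : MeasurableSet (piFundamentalDomain F κ) := measurableSet_piFundamentalDomain F κ
  have hmeasAD : MeasurableSet (A '' piFundamentalDomain F κ) :=
    A.toHomeomorph.toMeasurableEquiv.measurableSet_image.2 hmeasD
  have h1 : (ν.map A) (A '' piFundamentalDomain F κ) = ν (piFundamentalDomain F κ) := by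
    rw [Measure.map_apply A.continuous.measurable hmeasAD, Set.preimage_image_eq _ A.injective]
  have h2 : ν (A '' piFundamentalDomain F κ) = ν (piFundamentalDomain F κ) := hAD.measure_eq hD
  have hne : ν (piFundamentalDomain F κ) ≠ 0 :=
    hD.measure_ne_zero (Measure.measure_univ_ne_zero.1 (IsOpenPosMeasure.open_pos _ isOpen_univ Set.univ_nonempty))
  have htop : ν (piFundamentalDomain F κ) ≠ ⊤ :=
    (measure_mono subset_closure |>.trans_lt (isCompact_closure_piFundamentalDomain F κ).measure_lt_top).ne
  have hmul : (addHaarScalarFactor (ν.map A) ν : ENNReal) * ν (piFundamentalDomain F κ) =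
      1 * ν (piFundamentalDomain F κ) := by
    have := congrArg (fun μ : Measure _ => μ (A '' piFundamentalDomain F κ)) hc
    simp only [Measure.smul_apply, h1, h2, ENNReal.smul_def, smul_eq_mul] at this
    rw [one_mul]; exact this.symm
  have hcoef : addHaarScalarFactor (ν.map A) ν = 1 :=
    ENNReal.coe_eq_one.1 ((ENNReal.mul_left_inj hne htop).1 hmul)
  rw [hc, hcoef, one_smul]

/-- `y ↦ (A₀ ⊗ 1) y` is measure preserving. [folklore] -/
theorem measurePreserving_ratLinCLE (A₀ : Matrix κ κ F) (hA₀ : IsUnit A₀) :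
    MeasurePreserving (ratLinCLE A₀ hA₀) ν ν :=
  ⟨(ratLinCLE A₀ hA₀).continuous.measurable, map_ratLinCLE_eq ν A₀ hA₀⟩

/-- **(R4) Rational change of variables over the Tate domain**: for an `F^κ`-periodic `H`,
`∫_{D^κ} H((A₀ ⊗ 1) y) dν = ∫_{D^κ} H dν`. [folklore] -/
theorem setIntegral_comp_ratLinCLE_eq (A₀ : Matrix κ κ F) (hA₀ : IsUnit A₀)
    {H : (κ → AdeleRing (𝓞 F) F) → ℂ} (hper : ∀ (ζ : κ → F) (y), H (y + ratPt F κ ζ) = H y) :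
    ∫ y in piFundamentalDomain F κ, H (A₀.map (algebraMap F (AdeleRing (𝓞 F) F)) *ᵥ y) ∂ν =
      ∫ y in piFundamentalDomain F κ, H y ∂ν := by
  haveI : Countable F := NumberField.countable' (K := F)
  set A := ratLinCLE A₀ hA₀ with hA
  have hD := isAddFundamentalDomain_op_piFundamentalDomain F κ ν
  have hAD := isAddFundamentalDomain_image_ratLinCLE ν A₀ hA₀
  have hemb : MeasurableEmbedding A := A.toHomeomorph.toMeasurableEquiv.measurableEmbedding
  have h1 := (measurePreserving_ratLinCLE ν A₀ hA₀).setIntegral_image_emb hemb H (piFundamentalDomain F κ)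
  -- `∫_{A '' D} H = ∫_{D} H ∘ A`
  have hper' : ∀ (g : (piPrincipalSubgroup F κ).op) (x : κ → AdeleRing (𝓞 F) F), H (g +ᵥ x) = H x := by
    intro g x
    obtain ⟨ζ, hζ⟩ := exists_ratPt_eq_of_mem_piPrincipalSubgroup (AddSubgroup.mem_op.1 g.2)
    rw [AddSubgroup.vadd_def, AddOpposite.vadd_eq_add_unop, ← hζ, hper]
  have h2 : ∫ y in A '' piFundamentalDomain F κ, H y ∂ν = ∫ y in piFundamentalDomain F κ, H y ∂ν :=
    hAD.setIntegral_eq hD hper'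
  rw [← h2, h1]
  rfl

end RatLinear

section DiagTheta

variable {F : Type} [Field F] [NumberField F] {ι : Type} [Fintype ι] [DecidableEq ι]

/-- the point `((a,a),(b,b))` of the diagonal Lagrangian `W^Δ` attached to `z = (a,b) ∈ 𝔸^{ι ⊕ ι}`.
[cite: Li1992, p. 181] [cite: HarrisKudlaSweet1996, (1.3) p. 950] -/
def diagLagrangianPt (z : ι ⊕ ι → AdeleRing (𝓞 F) F) :
    (ι ⊕ ι → AdeleRing (𝓞 F) F) × (ι ⊕ ι → AdeleRing (𝓞 F) F) :=
  (Sum.elim (z ∘ Sum.inl) (z ∘ Sum.inl), Sum.elim (z ∘ Sum.inr) (z ∘ Sum.inr))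

omit [DecidableEq ι] in
/-- `W^Δ` is isotropic for the bilinear form `x ⬝ T₂ y` of the doubled space. [folklore] -/
theorem diagLagrangianPt_isotropic (T₀ : Matrix ι ι F) (z : ι ⊕ ι → AdeleRing (𝓞 F) F) :
    (diagLagrangianPt z).1 ⬝ᵥ (doubledGram (T₀.map (algebraMap F (AdeleRing (𝓞 F) F))) *ᵥ (diagLagrangianPt z).2) = 0 := by
  simp only [diagLagrangianPt, doubledGram, Matrix.fromBlocks_mulVec, Sum.elim_comp_inl, Sum.elim_comp_inr,
    Matrix.zero_mulVec, add_zero, zero_add, Matrix.neg_mulVec, dotProduct, Fintype.sum_sum_type,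
    Sum.elim_inl, Sum.elim_inr, Pi.neg_apply, mul_neg, Finset.sum_neg_distrib, add_neg_cancel]

/-- **The theta lift along the diagonal Lagrangian** as a function of `z = (a, b) ∈ 𝔸^{ι ⊕ ι}`:
`z ↦ Θ(ρ_{T₂}(((a,a),(b,b)),0) Ψ)`. [folklore] -/
def diagLagrangianTheta (T₀ : Matrix ι ι F) (Ψ : piSchwartzBruhat F (ι ⊕ ι)) (z : ι ⊕ ι → AdeleRing (𝓞 F) F) : ℂ :=
  thetaDist F (ι ⊕ ι) (adelicSchrodinger F (ι ⊕ ι) (doubledGram (T₀.map (algebraMap F (AdeleRing (𝓞 F) F))))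
    (Heisenberg.ofVec (polar (adelicForm F (ι ⊕ ι) (doubledGram (T₀.map (algebraMap F (AdeleRing (𝓞 F) F))))))
      (diagLagrangianPt z)) Ψ : (ι ⊕ ι → AdeleRing (𝓞 F) F) → ℂ)

/-- the diagonal frequency `(ξ₁ - ξ₂) T₀` of `ξ = (ξ₁, ξ₂)`. [folklore] -/
def diagLagrangianFreq (T₀ : Matrix ι ι F) (ξ : ι ⊕ ι → F) : ι → F := ((ξ ∘ Sum.inl) - (ξ ∘ Sum.inr)) ᵥ* T₀

/-- the `ξ`-th term of the series of `diagLagrangianTheta`. [folklore] -/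
def diagLagrangianTerm (T₀ : Matrix ι ι F) (Ψ : piSchwartzBruhat F (ι ⊕ ι)) (ξ : ι ⊕ ι → F)
    (z : ι ⊕ ι → AdeleRing (𝓞 F) F) : ℂ :=
  (Ψ : (ι ⊕ ι → AdeleRing (𝓞 F) F) → ℂ) (ratPt F (ι ⊕ ι) ξ + Sum.elim (z ∘ Sum.inl) (z ∘ Sum.inl)) *
    ((adeleAddChar F (∑ j, algebraMap F (AdeleRing (𝓞 F) F) (diagLagrangianFreq T₀ ξ j) * z (Sum.inr j)) : Circle) : ℂ)

/-- series expansion of `diagLagrangianTheta`. [folklore] -/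
theorem diagLagrangianTheta_eq_tsum (T₀ : Matrix ι ι F) (Ψ : piSchwartzBruhat F (ι ⊕ ι))
    (z : ι ⊕ ι → AdeleRing (𝓞 F) F) :
    diagLagrangianTheta T₀ Ψ z = ∑' ξ : ι ⊕ ι → F, diagLagrangianTerm T₀ Ψ ξ z := by
  unfold diagLagrangianTheta diagLagrangianPt diagLagrangianTerm diagLagrangianFreq
  rw [thetaDist_adelicSchrodinger_ofVec]
  refine tsum_congr fun ξ => ?_
  rw [piAdeleChar_apply, piPairing_doubledGram_mulVec_diag]
  rfl

/-- `diagLagrangianTheta` at `Sum.elim a b` is the theta lift at `((a,a),(b,b))`. [folklore] -/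
theorem diagLagrangianTheta_sumElim (T₀ : Matrix ι ι F) (Ψ : piSchwartzBruhat F (ι ⊕ ι))
    (a b : ι → AdeleRing (𝓞 F) F) :
    diagLagrangianTheta T₀ Ψ (Sum.elim a b) =
      thetaDist F (ι ⊕ ι) (adelicSchrodinger F (ι ⊕ ι) (doubledGram (T₀.map (algebraMap F (AdeleRing (𝓞 F) F))))
        (Heisenberg.ofVec (polar (adelicForm F (ι ⊕ ι) (doubledGram (T₀.map (algebraMap F (AdeleRing (𝓞 F) F))))))
          (Sum.elim a a, Sum.elim b b)) Ψ : (ι ⊕ ι → AdeleRing (𝓞 F) F) → ℂ) := by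
  simp only [diagLagrangianTheta, diagLagrangianPt, Sum.elim_comp_inl, Sum.elim_comp_inr]

omit [Fintype ι] [DecidableEq ι] in
/-- doubling the first half commutes with rational translation. [folklore] -/
private theorem dbl_inl_add_ratPt (z : ι ⊕ ι → AdeleRing (𝓞 F) F) (ζ : ι ⊕ ι → F) :
    Sum.elim ((z + ratPt F (ι ⊕ ι) ζ) ∘ Sum.inl) ((z + ratPt F (ι ⊕ ι) ζ) ∘ Sum.inl) =
      Sum.elim (z ∘ Sum.inl) (z ∘ Sum.inl) + ratPt F (ι ⊕ ι) (Sum.elim (ζ ∘ Sum.inl) (ζ ∘ Sum.inl)) := by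
  funext i
  rcases i with j | j <;> simp [ratPt_apply]

omit [NumberField F] [DecidableEq ι] in
/-- the diagonal frequency only sees `ξ₁ - ξ₂`. [folklore] -/
private theorem diagLagrangianFreq_add_dbl (T₀ : Matrix ι ι F) (ξ ζ : ι ⊕ ι → F) :
    diagLagrangianFreq T₀ (ξ + Sum.elim (ζ ∘ Sum.inl) (ζ ∘ Sum.inl)) = diagLagrangianFreq T₀ ξ := by
  unfold diagLagrangianFreq
  congr 1
  funext j
  simp

omit [DecidableEq ι] in
/-- rational translation of `z` shifts the series index. [folklore] -/
theorem diagLagrangianTerm_add_ratPt (T₀ : Matrix ι ι F) (Ψ : piSchwartzBruhat F (ι ⊕ ι)) (ξ : ι ⊕ ι → F)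
    (z : ι ⊕ ι → AdeleRing (𝓞 F) F) (ζ : ι ⊕ ι → F) :
    diagLagrangianTerm T₀ Ψ ξ (z + ratPt F (ι ⊕ ι) ζ) = diagLagrangianTerm T₀ Ψ (ξ + Sum.elim (ζ ∘ Sum.inl) (ζ ∘ Sum.inl)) z := by
  simp only [diagLagrangianTerm]
  rw [dbl_inl_add_ratPt, diagLagrangianFreq_add_dbl, ratPt_add]
  congr 1
  · abel_nf
  · have : ∑ j, algebraMap F (AdeleRing (𝓞 F) F) (diagLagrangianFreq T₀ ξ j) * (z + ratPt F (ι ⊕ ι) ζ) (Sum.inr j) =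
        ∑ j, algebraMap F (AdeleRing (𝓞 F) F) (diagLagrangianFreq T₀ ξ j) * z (Sum.inr j) +
          algebraMap F (AdeleRing (𝓞 F) F) (∑ j, diagLagrangianFreq T₀ ξ j * ζ (Sum.inr j)) := by
      simp only [Pi.add_apply, ratPt_apply, mul_add, Finset.sum_add_distrib, _root_.map_sum, map_mul]
    rw [this, AddChar.map_add_eq_mul, adeleAddChar_algebraMap, mul_one]

/-- **`F^{ι ⊕ ι}`-periodicity of the diagonal theta lift.** [folklore] -/
theorem diagLagrangianTheta_add_ratPt (T₀ : Matrix ι ι F) (Ψ : piSchwartzBruhat F (ι ⊕ ι))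
    (z : ι ⊕ ι → AdeleRing (𝓞 F) F) (ζ : ι ⊕ ι → F) :
    diagLagrangianTheta T₀ Ψ (z + ratPt F (ι ⊕ ι) ζ) = diagLagrangianTheta T₀ Ψ z := by
  rw [diagLagrangianTheta_eq_tsum, diagLagrangianTheta_eq_tsum]
  simp_rw [diagLagrangianTerm_add_ratPt]
  exact (Equiv.addRight (Sum.elim (ζ ∘ Sum.inl) (ζ ∘ Sum.inl))).tsum_eq (fun ξ => diagLagrangianTerm T₀ Ψ ξ z)

/-- **Continuity of the diagonal theta lift** (M-test on compacta). [folklore] -/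
theorem continuous_diagLagrangianTheta (T₀ : Matrix ι ι F) (Ψ : piSchwartzBruhat F (ι ⊕ ι)) :
    Continuous (diagLagrangianTheta T₀ Ψ) := by
  have hΨ := Ψ.2
  have hc : Continuous (Ψ : (ι ⊕ ι → AdeleRing (𝓞 F) F) → ℂ) := continuous_of_mem_piSchwartzBruhat hΨ
  have hdbl : Continuous fun z : ι ⊕ ι → AdeleRing (𝓞 F) F => Sum.elim (z ∘ Sum.inl) (z ∘ Sum.inl) :=
    continuous_pi fun i => by rcases i with j | j <;> simpa using continuous_apply (Sum.inl j)
  rw [show diagLagrangianTheta T₀ Ψ = fun z => ∑' ξ : ι ⊕ ι → F, diagLagrangianTerm T₀ Ψ ξ z from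
    funext (diagLagrangianTheta_eq_tsum T₀ Ψ)]
  refine continuous_tsum_of_dominated_on_compacts (fun ξ => ?_) fun C hC => ?_
  · exact (hc.comp (continuous_const.add hdbl)).mul (continuous_subtype_val.comp
      ((continuous_adeleAddChar F).comp (continuous_finsetSum _ fun j _ =>
        continuous_const.mul (continuous_apply _))))
  · obtain ⟨u, hu, hb⟩ := exists_summable_majorant_of_mem_piSchwartzBruhat hΨ (hC.image hdbl)
    refine ⟨u, hu, fun ξ z hz => ?_⟩
    rw [diagLagrangianTerm, norm_mul, Circle.norm_coe, mul_one, add_comm]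
    exact hb _ ⟨z, hz, rfl⟩ ξ

end DiagTheta

section Product

variable {F : Type} [Field F] [NumberField F] {ι : Type} [Fintype ι]

variable (F ι) in
/-- `(a, b) ↦ Sum.elim a b : 𝔸^ι × 𝔸^ι ≃ 𝔸^{ι ⊕ ι}` as a continuous linear equivalence. [folklore] -/
def sumElimCLE : ((ι → AdeleRing (𝓞 F) F) × (ι → AdeleRing (𝓞 F) F)) ≃L[AdeleRing (𝓞 F) F]
    (ι ⊕ ι → AdeleRing (𝓞 F) F) where
  toFun p := Sum.elim p.1 p.2
  invFun z := (z ∘ Sum.inl, z ∘ Sum.inr)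
  map_add' p q := by funext i; rcases i with j | j <;> rfl
  map_smul' c p := by funext i; rcases i with j | j <;> rfl
  left_inv p := by simp
  right_inv z := Sum.elim_comp_inl_inr z
  continuous_toFun := continuous_pi fun i => by
    rcases i with j | j
    · exact (continuous_apply j).comp continuous_fst
    · exact (continuous_apply j).comp continuous_snd
  continuous_invFun := (continuous_pi fun j => continuous_apply (Sum.inl j)).prodMk
    (continuous_pi fun j => continuous_apply (Sum.inr j))

omit [Fintype ι] in
/-- formula for `sumElimCLE`. [folklore] -/
@[simp] theorem sumElimCLE_apply (p : (ι → AdeleRing (𝓞 F) F) × (ι → AdeleRing (𝓞 F) F)) :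
    sumElimCLE F ι p = Sum.elim p.1 p.2 := rfl

omit [Fintype ι] in
/-- the Tate box of `ι ⊕ ι` is the product of the two Tate boxes of `ι`. [folklore] -/
theorem sumElimCLE_preimage_piFundamentalDomain :
    (sumElimCLE F ι) ⁻¹' piFundamentalDomain F (ι ⊕ ι) = piFundamentalDomain F ι ×ˢ piFundamentalDomain F ι := by
  ext p
  simp only [Set.mem_preimage, piFundamentalDomain, Set.mem_univ_pi, Sum.forall, sumElimCLE_apply, Sum.elim_inl,
    Sum.elim_inr, Set.mem_prod]

variable [MeasurableSpace (AdeleRing (𝓞 F) F)] [BorelSpace (AdeleRing (𝓞 F) F)]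
  (ν : Measure (ι → AdeleRing (𝓞 F) F)) [ν.IsAddHaarMeasure]

/-- the product Haar measure `ν ⊗ ν` transported to `𝔸^{ι ⊕ ι}`. [folklore] -/
def sumElimMeasure : Measure (ι ⊕ ι → AdeleRing (𝓞 F) F) := (ν.prod ν).map (sumElimCLE F ι)

/-- the transported product measure is an additive Haar measure. [folklore] -/
instance isAddHaarMeasure_sumElimMeasure : (sumElimMeasure ν).IsAddHaarMeasure := by
  haveI : (ν.prod ν).IsAddHaarMeasure := inferInstance
  unfold sumElimMeasure
  exact ContinuousLinearEquiv.isAddHaarMeasure_map (sumElimCLE F ι) (ν.prod ν)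

/-- `(ν ⊗ ν)(D^{ι ⊕ ι}) = ν(D^ι)²`. [folklore] -/
theorem sumElimMeasure_piFundamentalDomain :
    sumElimMeasure ν (piFundamentalDomain F (ι ⊕ ι)) = ν (piFundamentalDomain F ι) * ν (piFundamentalDomain F ι) := by
  rw [sumElimMeasure, Measure.map_apply (sumElimCLE F ι).continuous.measurable (measurableSet_piFundamentalDomain F _),
    sumElimCLE_preimage_piFundamentalDomain, Measure.prod_prod]

/-- **Fubini over the Tate domain of the doubled space** for a continuous integrand. [folklore] -/
theorem setIntegral_sumElimMeasure_eq (H : (ι ⊕ ι → AdeleRing (𝓞 F) F) → ℂ) (hH : Continuous H) :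
    ∫ z in piFundamentalDomain F (ι ⊕ ι), H z ∂(sumElimMeasure ν) =
      ∫ a in piFundamentalDomain F ι, ∫ b in piFundamentalDomain F ι, H (Sum.elim a b) ∂ν ∂ν := by
  have hemb : MeasurableEmbedding (sumElimCLE F ι) :=
    (sumElimCLE F ι).toHomeomorph.toMeasurableEquiv.measurableEmbedding
  rw [sumElimMeasure, hemb.setIntegral_map, sumElimCLE_preimage_piFundamentalDomain]
  have hint : IntegrableOn (fun p : (ι → AdeleRing (𝓞 F) F) × (ι → AdeleRing (𝓞 F) F) => H (sumElimCLE F ι p))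
      (piFundamentalDomain F ι ×ˢ piFundamentalDomain F ι) (ν.prod ν) :=
    ((hH.comp (sumElimCLE F ι).continuous).continuousOn.integrableOn_compact
      ((isCompact_closure_piFundamentalDomain F ι).prod (isCompact_closure_piFundamentalDomain F ι))).mono_set
      (Set.prod_mono subset_closure subset_closure)
  rw [setIntegral_prod _ hint]
  rfl

end Product

section Core

variable {F : Type} [Field F] [NumberField F] {ι κ : Type} [Fintype ι] [DecidableEq ι] [Fintype κ] [DecidableEq κ]

omit [Fintype ι] [DecidableEq ι] in
/-- the doubled Gram matrix is rational: `T₂ = (fromBlocks T₀ 0 0 (-T₀)) ⊗ 1`. [folklore] -/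
theorem doubledGram_map (T₀ : Matrix ι ι F) :
    doubledGram (T₀.map (algebraMap F (AdeleRing (𝓞 F) F))) =
      (Matrix.fromBlocks T₀ 0 0 (-T₀)).map (algebraMap F (AdeleRing (𝓞 F) F)) := by
  rw [Matrix.fromBlocks_map, Matrix.map_neg _ (map_neg _), Matrix.map_zero _ (map_zero _)]

omit [NumberField F] in
/-- `fromBlocks T₀ 0 0 (-T₀)` is invertible when `T₀` is. [folklore] -/
theorem isUnit_fromBlocks_neg (T₀ : Matrix ι ι F) (hT₀ : IsUnit T₀) :
    IsUnit (Matrix.fromBlocks T₀ 0 0 (-T₀)) := by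
  rw [Matrix.isUnit_iff_isUnit_det, Matrix.det_fromBlocks_zero₂₁]
  exact ((Matrix.isUnit_iff_isUnit_det _).1 hT₀).mul ((Matrix.isUnit_iff_isUnit_det _).1 hT₀.neg)

/-- **(R2) Implementers intertwine**: `ρ(h) (M Ψ) = M (ρ(s⁻¹·h) Ψ)` for `(π(p), M) = p ∈ Mp_ψ(W_𝔸)`,
`s = ofSymplectic (π p)`. [cite: Weil1964, Chap. I n° 4 p. 149] [folklore] -/
theorem adelicSchrodinger_toOp (T : Matrix κ κ (AdeleRing (𝓞 F) F)) (p : adelicMp F κ T)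
    (h : AdelicHeisenberg F κ T) (Ψ : piSchwartzBruhat F κ) :
    adelicSchrodinger F κ T h (MpPsi.toOp (adelicSchrodinger F κ T) p Ψ) =
      MpPsi.toOp (adelicSchrodinger F κ T) p
        (adelicSchrodinger F κ T ((ofSymplectic _ (MpPsi.proj (adelicSchrodinger F κ T) p))⁻¹.act h) Ψ) := by
  have himp : Implements (adelicSchrodinger F κ T) (ofSymplectic _ (MpPsi.proj (adelicSchrodinger F κ T) p))
      (MpPsi.toOp (adelicSchrodinger F κ T) p) :=
    (mem_MpPsi _ _).1 p.2
  rw [himp, ← Heisenberg.PseudoSymplectic.act_mul_act, mul_inv_cancel, Heisenberg.PseudoSymplectic.act_one]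

/-- The symplectic cocycle of `ofSymplectic` vanishes along an isotropic vector mapped into `{0} × 𝔸^κ`:
`(ofSymplectic g)⁻¹ · ((0,y),0) = (l, 0)` when `g l = (0,y)` and `B(l,l) = 0`.
[cite: Weil1964, Chap. I n° 5 pp. 150–151] [folklore] -/
theorem ofSymplectic_inv_act_ofVec (T : Matrix κ κ (AdeleRing (𝓞 F) F))
    (g : symplecticGroup (polar (adelicForm F κ T)))
    (l : (κ → AdeleRing (𝓞 F) F) × (κ → AdeleRing (𝓞 F) F)) (y : κ → AdeleRing (𝓞 F) F)
    (hl : (g : _ ≃ₗ[AdeleRing (𝓞 F) F] _) l = ((0 : κ → AdeleRing (𝓞 F) F), y)) (hB : l.1 ⬝ᵥ (T *ᵥ l.2) = 0) :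
    (ofSymplectic _ g)⁻¹.act (Heisenberg.ofVec (polar (adelicForm F κ T)) (0, y)) =
      Heisenberg.ofVec (polar (adelicForm F κ T)) l := by
  have hsymm : (g : _ ≃ₗ[AdeleRing (𝓞 F) F] _).symm ((0 : κ → AdeleRing (𝓞 F) F), y) = l := by
    rw [LinearEquiv.symm_apply_eq]
    exact hl.symm
  have hl' : (ofSymplectic (polar (adelicForm F κ T)) g).σ⁻¹ ((0 : κ → AdeleRing (𝓞 F) F), y) = l := hsymm
  refine Heisenberg.ext ?_ ?_
  · simp only [Heisenberg.PseudoSymplectic.act_v, Heisenberg.PseudoSymplectic.inv_σ, Heisenberg.ofVec_v, hl']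
  · simp only [Heisenberg.PseudoSymplectic.act_t, Heisenberg.PseudoSymplectic.inv_f, Heisenberg.ofVec_t,
      ofSymplectic_f, zero_add]
    have hσ : (ofSymplectic (polar (adelicForm F κ T)) g).σ l = ((0 : κ → AdeleRing (𝓞 F) F), y) := hl
    rw [ofSymplectic_σ] at hσ
    simp [hσ, hsymm, polar_apply, adelicForm_apply, hB]

variable [MeasurableSpace (AdeleRing (𝓞 F) F)] [BorelSpace (AdeleRing (𝓞 F) F)]

/-- (R1) with the rationality of `T` supplied as an equation (avoids transport in dependent types). [folklore] -/
theorem setIntegral_thetaDist_adelicSchrodinger_ofVec' (ν : Measure (κ → AdeleRing (𝓞 F) F))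
    [ν.IsAddHaarMeasure] (T : Matrix κ κ (AdeleRing (𝓞 F) F)) (T₀ : Matrix κ κ F)
    (hT : T = T₀.map (algebraMap F (AdeleRing (𝓞 F) F))) (hT₀ : IsUnit T₀)
    (x : κ → AdeleRing (𝓞 F) F) (Φ : piSchwartzBruhat F κ) :
    ∫ y in piFundamentalDomain F κ,
        (thetaDist F κ (adelicSchrodinger F κ T (Heisenberg.ofVec (polar (adelicForm F κ T)) (x, y)) Φ :
          (κ → AdeleRing (𝓞 F) F) → ℂ)) ∂ν =
      ((ν (piFundamentalDomain F κ)).toReal : ℂ) * (Φ : (κ → AdeleRing (𝓞 F) F) → ℂ) x := by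
  subst hT
  exact setIntegral_thetaDist_adelicSchrodinger_ofVec ν T₀ hT₀ x Φ

variable (ν : Measure (ι → AdeleRing (𝓞 F) F)) [ν.IsAddHaarMeasure]

/-- **CORE THEOREM (S4-10 kernel item (b), `c = 1`).** Let `T₀ ∈ GL_ι(F)`, `T₂ = T ⊕ (-T)`, `T = T₀ ⊗ 1`, and let
`p = (g, M)` be a `Θ`-fixing pair of `Mp_ψ(W_𝔸)` over the doubled space whose projection `g` carries the diagonal
Lagrangian `W^Δ` onto `𝕐 = {0} × 𝔸^{ι⊕ι}` through a rational linear parametrisation `A₀ ∈ GL_{ι⊕ι}(F)`: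
`g((a,a),(b,b)) = (0, y)` whenever `(a,b) = (A₀ ⊗ 1) y`. Then for every `Ψ ∈ 𝒮(𝔸^{ι⊕ι})`,
`ν(D^ι) · (M Ψ)(0) = ∫_{𝔸^ι} Ψ(u,u) dν(u)`.
[cite: Li1992, (13) pp. 181–182] [cite: HarrisKudlaSweet1996, (1.16) p. 952] -/
theorem measure_mul_toOp_apply_zero_eq_integral_diag (T₀ : Matrix ι ι F) (hT₀ : IsUnit T₀)
    (A₀ : Matrix (ι ⊕ ι) (ι ⊕ ι) F) (hA₀ : IsUnit A₀)
    (p : adelicMp F (ι ⊕ ι) (doubledGram (T₀.map (algebraMap F (AdeleRing (𝓞 F) F)))))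
    (hΘ : p ∈ adelicMpTheta F (ι ⊕ ι) (doubledGram (T₀.map (algebraMap F (AdeleRing (𝓞 F) F)))))
    (hW : ∀ y : ι ⊕ ι → AdeleRing (𝓞 F) F,
      (MpPsi.proj (adelicSchrodinger F (ι ⊕ ι) (doubledGram (T₀.map (algebraMap F (AdeleRing (𝓞 F) F))))) p :
          _ ≃ₗ[AdeleRing (𝓞 F) F] _) (diagLagrangianPt (A₀.map (algebraMap F (AdeleRing (𝓞 F) F)) *ᵥ y)) =
        ((0 : ι ⊕ ι → AdeleRing (𝓞 F) F), y))
    (Ψ : piSchwartzBruhat F (ι ⊕ ι)) :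
    ((ν (piFundamentalDomain F ι)).toReal : ℂ) *
        ((MpPsi.toOp (adelicSchrodinger F (ι ⊕ ι) (doubledGram (T₀.map (algebraMap F (AdeleRing (𝓞 F) F))))) p Ψ :
          piSchwartzBruhat F (ι ⊕ ι)) : (ι ⊕ ι → AdeleRing (𝓞 F) F) → ℂ) 0 =
      ∫ u, (Ψ : (ι ⊕ ι → AdeleRing (𝓞 F) F) → ℂ) (Sum.elim u u) ∂ν := by
  haveI : Countable F := NumberField.countable' (K := F)
  set Φ' : piSchwartzBruhat F (ι ⊕ ι) := MpPsi.toOp (adelicSchrodinger F (ι ⊕ ι) (doubledGram (T₀.map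
      (algebraMap F (AdeleRing (𝓞 F) F))))) p Ψ with hΦ'
  -- (R1) on the doubled space, for the transported product measure
  have h1 := setIntegral_thetaDist_adelicSchrodinger_ofVec' (sumElimMeasure ν) (doubledGram (T₀.map (algebraMap
      F (AdeleRing (𝓞 F) F)))) _ (doubledGram_map T₀)
    (isUnit_fromBlocks_neg T₀ hT₀) 0 Φ'
  -- (R2) + (R3): the integrand is the diagonal theta lift of `Ψ` at `(A₀ ⊗ 1) y`
  have h2 : ∀ y : ι ⊕ ι → AdeleRing (𝓞 F) F,
      thetaDist F (ι ⊕ ι) (adelicSchrodinger F (ι ⊕ ι) (doubledGram (T₀.map (algebraMap F (AdeleRing (𝓞 F) F))))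
        (Heisenberg.ofVec (polar (adelicForm F (ι ⊕ ι) (doubledGram (T₀.map (algebraMap F (AdeleRing (𝓞 F) F)))))) (0, y)) Φ' :
          (ι ⊕ ι → AdeleRing (𝓞 F) F) → ℂ) =
        diagLagrangianTheta T₀ Ψ (A₀.map (algebraMap F (AdeleRing (𝓞 F) F)) *ᵥ y) := by
    intro y
    rw [hΦ', adelicSchrodinger_toOp, (mem_adelicMpTheta_iff p).1 hΘ,
      ofSymplectic_inv_act_ofVec (doubledGram (T₀.map (algebraMap F (AdeleRing (𝓞 F) F)))) _ (diagLagrangianPt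
          (A₀.map (algebraMap F (AdeleRing (𝓞 F) F)) *ᵥ y)) y (hW y)
        (diagLagrangianPt_isotropic T₀ _)]
    rfl
  -- (R4): drop the rational change of variables
  have h3 := setIntegral_comp_ratLinCLE_eq (sumElimMeasure ν) A₀ hA₀ (H := diagLagrangianTheta T₀ Ψ)
    (fun ζ y => diagLagrangianTheta_add_ratPt T₀ Ψ y ζ)
  -- Fubini + (R5) + (R6)
  have h4 : ∫ z in piFundamentalDomain F (ι ⊕ ι), diagLagrangianTheta T₀ Ψ z ∂(sumElimMeasure ν) =
      ((ν (piFundamentalDomain F ι)).toReal : ℂ) * ∫ u, (Ψ : (ι ⊕ ι → AdeleRing (𝓞 F) F) → ℂ) (Sum.elim u u) ∂ν := by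
    rw [setIntegral_sumElimMeasure_eq ν _ (continuous_diagLagrangianTheta T₀ Ψ)]
    simp_rw [diagLagrangianTheta_sumElim, setIntegral_thetaDist_diag ν T₀ hT₀]
    rw [integral_const_mul, setIntegral_tsum_diag ν Ψ]
  -- measures
  have hD := isAddFundamentalDomain_op_piFundamentalDomain F ι ν
  have hne : ν (piFundamentalDomain F ι) ≠ 0 :=
    hD.measure_ne_zero (Measure.measure_univ_ne_zero.1 (IsOpenPosMeasure.open_pos _ isOpen_univ Set.univ_nonempty))
  have htop : ν (piFundamentalDomain F ι) ≠ ⊤ :=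
    (measure_mono subset_closure |>.trans_lt (isCompact_closure_piFundamentalDomain F ι).measure_lt_top).ne
  have hD2 : ((sumElimMeasure ν) (piFundamentalDomain F (ι ⊕ ι))).toReal =
      (ν (piFundamentalDomain F ι)).toReal * (ν (piFundamentalDomain F ι)).toReal := by
    rw [sumElimMeasure_piFundamentalDomain, ENNReal.toReal_mul]
  have key : ((ν (piFundamentalDomain F ι)).toReal : ℂ) *
      (((ν (piFundamentalDomain F ι)).toReal : ℂ) * (Φ' : (ι ⊕ ι → AdeleRing (𝓞 F) F) → ℂ) 0) =
      ((ν (piFundamentalDomain F ι)).toReal : ℂ) * ∫ u, (Ψ : (ι ⊕ ι → AdeleRing (𝓞 F) F) → ℂ) (Sum.elim u u) ∂ν := by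
    rw [← mul_assoc, ← Complex.ofReal_mul, ← hD2, ← h1, setIntegral_congr_fun (measurableSet_piFundamentalDomain F _)
      (fun y _ => h2 y), h3, h4]
  have hne' : ((ν (piFundamentalDomain F ι)).toReal : ℂ) ≠ 0 := by
    exact_mod_cast (ENNReal.toReal_pos hne htop).ne'
  exact mul_left_cancel₀ hne' key

end Core

section Lagrangian

/-! ## §8. From `γ(W^Δ) ⊆ 𝕐` to the rational parametrisation

Linear algebra over `F`: in Weil's Darboux coordinates `(x, y) ↦ (x, T₂ y)` (`SymplecticMatrix.darboux`) a point
`((c₁,c₁),(c₂,c₂))` of `W^Δ` has coordinates `(M₁ c, M₂ c)` with the RATIONAL matrices `M₁ = [[1,0],[1,0]]`,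
`M₂ = [[0,T₀],[0,-T₀]]`; so for `γ = [[α,β],[γ',δ]] ∈ Sp(F)`, `r(γ)((c₁,c₁),(c₂,c₂)) = ((P₀ ⊗ 1) c, T₂⁻¹ (Q₀ ⊗ 1) c)`
with `P₀ = α M₁ + β M₂`, `Q₀ = γ' M₁ + δ M₂ ∈ M_{ι⊕ι}(F)`.  `γ(W^Δ) ⊆ 𝕐` says `P₀ ⊗ 1 = 0`, i.e. `P₀ = 0`
(`F ↪ 𝔸`); then `Q₀` is injective on `F^{ι⊕ι}` (`γ` and `c ↦ (M₁ c, M₂ c)` are), hence invertible, and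
`A₀ = Q₀⁻¹ (T₀ ⊕ (-T₀))` is the rational parametrisation: `γ (diag ((A₀ ⊗ 1) y)) = (0, y)`. -/

variable {F : Type} [Field F] [NumberField F] {ι : Type} [Fintype ι] [DecidableEq ι]

/-- `M₁ = [[1,0],[1,0]]`: `M₁ c = (c₁, c₁)`. [folklore] -/
def diagDarbouxFst : Matrix (ι ⊕ ι) (ι ⊕ ι) F := Matrix.fromBlocks 1 0 1 0

/-- `M₂ = [[0,T₀],[0,-T₀]]`: `M₂ c = (T₀ c₂, -T₀ c₂)`. [folklore] -/
def diagDarbouxSnd (T₀ : Matrix ι ι F) : Matrix (ι ⊕ ι) (ι ⊕ ι) F := Matrix.fromBlocks 0 T₀ 0 (-T₀)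

/-- `(M₁ ⊗ 1) c = (c₁, c₁)`. [folklore] -/
theorem diagDarbouxFst_map_mulVec (c : ι ⊕ ι → AdeleRing (𝓞 F) F) :
    (diagDarbouxFst : Matrix (ι ⊕ ι) (ι ⊕ ι) F).map (algebraMap F (AdeleRing (𝓞 F) F)) *ᵥ c = Sum.elim (c ∘ Sum.inl) (c ∘ Sum.inl) := by
  rw [diagDarbouxFst, Matrix.fromBlocks_map, ← Sum.elim_comp_inl_inr c, Matrix.fromBlocks_mulVec]
  simp [Matrix.map_one, Matrix.map_zero]

omit [DecidableEq ι] in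
/-- `(M₂ ⊗ 1) c = T₂ (c₂, c₂)`. [folklore] -/
theorem diagDarbouxSnd_map_mulVec (T₀ : Matrix ι ι F) (c : ι ⊕ ι → AdeleRing (𝓞 F) F) :
    (diagDarbouxSnd T₀).map (algebraMap F (AdeleRing (𝓞 F) F)) *ᵥ c =
      doubledGram (T₀.map (algebraMap F (AdeleRing (𝓞 F) F))) *ᵥ Sum.elim (c ∘ Sum.inr) (c ∘ Sum.inr) := by
  conv_lhs => rw [← Sum.elim_comp_inl_inr c]
  rw [diagDarbouxSnd, Matrix.fromBlocks_map, Matrix.fromBlocks_mulVec, doubledGram, Matrix.fromBlocks_mulVec]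
  simp [Matrix.map_zero, Matrix.map_neg]

omit [NumberField F] in
/-- `M₁ c = (c₁, c₁)` (rational). [folklore] -/
theorem diagDarbouxFst_mulVec (c : ι ⊕ ι → F) :
    (diagDarbouxFst : Matrix (ι ⊕ ι) (ι ⊕ ι) F) *ᵥ c = Sum.elim (c ∘ Sum.inl) (c ∘ Sum.inl) := by
  rw [diagDarbouxFst, ← Sum.elim_comp_inl_inr c, Matrix.fromBlocks_mulVec]
  simp

omit [NumberField F] [DecidableEq ι] in
/-- `M₂ c = (T₀ c₂, -T₀ c₂)` (rational). [folklore] -/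
theorem diagDarbouxSnd_mulVec (T₀ : Matrix ι ι F) (c : ι ⊕ ι → F) :
    diagDarbouxSnd T₀ *ᵥ c = Sum.elim (T₀ *ᵥ (c ∘ Sum.inr)) (-(T₀ *ᵥ (c ∘ Sum.inr))) := by
  rw [diagDarbouxSnd, ← Sum.elim_comp_inl_inr c, Matrix.fromBlocks_mulVec]
  simp [Matrix.neg_mulVec]

/-- **Darboux coordinates of a point of `W^Δ`**: `darboux_{T₂} (diag c) = ((M₁ ⊗ 1) c, (M₂ ⊗ 1) c)`. [folklore] -/
theorem darboux_diagLagrangianPt (T₀ : Matrix ι ι F)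
    (hT : IsUnit (doubledGram (T₀.map (algebraMap F (AdeleRing (𝓞 F) F)))).det) (c : ι ⊕ ι → AdeleRing (𝓞 F) F) :
    SymplecticMatrix.darboux (doubledGram (T₀.map (algebraMap F (AdeleRing (𝓞 F) F)))) hT (diagLagrangianPt c) =
      Sum.elim ((diagDarbouxFst : Matrix (ι ⊕ ι) (ι ⊕ ι) F).map (algebraMap F (AdeleRing (𝓞 F) F)) *ᵥ c)
        ((diagDarbouxSnd T₀).map (algebraMap F (AdeleRing (𝓞 F) F)) *ᵥ c) := by
  rw [SymplecticMatrix.darboux_apply, diagDarbouxFst_map_mulVec, diagDarbouxSnd_map_mulVec]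
  rfl

/-- `P₀ = α M₁ + β M₂`, the first Darboux block of `γ = [[α,β],[γ',δ]]` on `W^Δ`. [folklore] -/
def diagFstBlock (T₀ : Matrix ι ι F) (γ : Matrix.symplecticGroup (ι ⊕ ι) F) : Matrix (ι ⊕ ι) (ι ⊕ ι) F :=
  γ.1.toBlocks₁₁ * diagDarbouxFst + γ.1.toBlocks₁₂ * diagDarbouxSnd T₀

/-- `Q₀ = γ' M₁ + δ M₂`, the second Darboux block of `γ = [[α,β],[γ',δ]]` on `W^Δ`. [folklore] -/
def diagSndBlock (T₀ : Matrix ι ι F) (γ : Matrix.symplecticGroup (ι ⊕ ι) F) : Matrix (ι ⊕ ι) (ι ⊕ ι) F :=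
  γ.1.toBlocks₂₁ * diagDarbouxFst + γ.1.toBlocks₂₂ * diagDarbouxSnd T₀

omit [NumberField F] in
/-- block multiplication: `γ (M₁ c, M₂ c) = (P₀ c, Q₀ c)` (rational). [folklore] -/
theorem symplectic_mulVec_diagDarboux (T₀ : Matrix ι ι F) (γ : Matrix.symplecticGroup (ι ⊕ ι) F) (c : ι ⊕ ι → F) :
    γ.1 *ᵥ Sum.elim (diagDarbouxFst *ᵥ c) (diagDarbouxSnd T₀ *ᵥ c) =
      Sum.elim (diagFstBlock T₀ γ *ᵥ c) (diagSndBlock T₀ γ *ᵥ c) := by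
  conv_lhs => rw [← Matrix.fromBlocks_toBlocks γ.1]
  rw [Matrix.fromBlocks_mulVec]
  simp only [diagFstBlock, diagSndBlock, Matrix.add_mulVec, Matrix.mulVec_mulVec, Sum.elim_comp_inl,
    Sum.elim_comp_inr]

/-- **`r(γ)` on `W^Δ` in blocks**: `r(γ) (diag c) = ((P₀ ⊗ 1) c, T₂⁻¹ ((Q₀ ⊗ 1) c))` for the rational symplectic
element `r(γ) = ratSpι γ` (`= darboux⁻¹ ∘ (γ ⊗ 1) ∘ darboux`, `SymplecticMatrix.coe_transportSp_apply`). [folklore] -/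
theorem ratSpι_diagLagrangianPt (T₀ : Matrix ι ι F) (hT : IsUnit (doubledGram (T₀.map (algebraMap F (AdeleRing (𝓞 F) F)))).det)
    (γ : Matrix.symplecticGroup (ι ⊕ ι) F) (c : ι ⊕ ι → AdeleRing (𝓞 F) F) :
    (ratSpι F (ι ⊕ ι) (doubledGram (T₀.map (algebraMap F (AdeleRing (𝓞 F) F)))) hT γ : _ ≃ₗ[AdeleRing (𝓞 F) F] _) (diagLagrangianPt c) =
      ((diagFstBlock T₀ γ).map (algebraMap F (AdeleRing (𝓞 F) F)) *ᵥ c,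
        (doubledGram (T₀.map (algebraMap F (AdeleRing (𝓞 F) F))))⁻¹ *ᵥ ((diagSndBlock T₀ γ).map (algebraMap F (AdeleRing (𝓞 F) F)) *ᵥ c)) := by
  rw [show ratSpι F (ι ⊕ ι) _ hT γ =
      SymplecticMatrix.transportSp _ hT (SymplecticMatrix.mapHom (algebraMap F (AdeleRing (𝓞 F) F)) γ) from rfl,
    SymplecticMatrix.coe_transportSp_apply, SymplecticMatrix.coe_mapHom, darboux_diagLagrangianPt,
    SymplecticMatrix.darboux_symm_apply]
  conv_lhs => rw [← Matrix.fromBlocks_toBlocks γ.1]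
  rw [Matrix.fromBlocks_map, Matrix.fromBlocks_mulVec]
  have hadd := fun M N : Matrix (ι ⊕ ι) (ι ⊕ ι) F =>
    Matrix.map_add (algebraMap F (AdeleRing (𝓞 F) F)) (map_add (algebraMap F (AdeleRing (𝓞 F) F))) M N
  simp only [Sum.elim_comp_inl, Sum.elim_comp_inr, diagFstBlock, diagSndBlock, hadd, Matrix.map_mul,
    Matrix.add_mulVec, Matrix.mulVec_mulVec, Matrix.mulVec_add]

/-- **`γ(W^Δ) ⊆ 𝕐` forces `P₀ = 0`** (apply to `F ↪ 𝔸`). [folklore] -/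
theorem diagFstBlock_eq_zero (T₀ : Matrix ι ι F) (hT : IsUnit (doubledGram (T₀.map (algebraMap F (AdeleRing (𝓞 F) F)))).det)
    (γ : Matrix.symplecticGroup (ι ⊕ ι) F)
    (hγ : ∀ a b : ι → AdeleRing (𝓞 F) F,
      ((ratSpι F (ι ⊕ ι) (doubledGram (T₀.map (algebraMap F (AdeleRing (𝓞 F) F)))) hT γ :
        ((ι ⊕ ι → AdeleRing (𝓞 F) F) × (ι ⊕ ι → AdeleRing (𝓞 F) F)) ≃ₗ[AdeleRing (𝓞 F) F] ((ι ⊕ ι → AdeleRing (𝓞 F) F) × (ι ⊕ ι → AdeleRing (𝓞 F) F))) (Sum.elim a a, Sum.elim b b)).1 = 0) :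
    diagFstBlock T₀ γ = 0 := by
  apply Matrix.map_injective (NumberField.AdeleRing.algebraMap_injective (𝓞 F) F)
  dsimp only
  rw [Matrix.map_zero _ (map_zero _)]
  refine Matrix.ext_iff_mulVec.2 fun c => ?_
  rw [Matrix.zero_mulVec]
  have h := hγ (c ∘ Sum.inl) (c ∘ Sum.inr)
  rw [show ((Sum.elim (c ∘ Sum.inl) (c ∘ Sum.inl), Sum.elim (c ∘ Sum.inr) (c ∘ Sum.inr)) :
      (ι ⊕ ι → AdeleRing (𝓞 F) F) × (ι ⊕ ι → AdeleRing (𝓞 F) F)) = diagLagrangianPt c from rfl, ratSpι_diagLagrangianPt] at h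
  exact h

omit [NumberField F] in
/-- a symplectic matrix is invertible. [folklore] -/
theorem isUnit_coe_symplecticGroup (γ : Matrix.symplecticGroup (ι ⊕ ι) F) : IsUnit γ.1 := by
  rw [Matrix.isUnit_iff_isUnit_det]
  refine Matrix.isUnit_det_of_left_inverse (A := γ.1) (B := (γ⁻¹ : Matrix.symplecticGroup (ι ⊕ ι) F).1) ?_
  exact congrArg Subtype.val (inv_mul_cancel γ)

omit [NumberField F] in
/-- **with `P₀ = 0` and `T₀ ∈ GL_ι(F)`, `Q₀` is invertible**: `Q₀ c = 0 ⇒ γ (M₁ c, M₂ c) = 0 ⇒ (c₁, c₁) = 0` and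
`T₀ c₂ = 0`. [folklore] -/
theorem isUnit_diagSndBlock (T₀ : Matrix ι ι F) (hT₀ : IsUnit T₀) (γ : Matrix.symplecticGroup (ι ⊕ ι) F)
    (hP : diagFstBlock T₀ γ = 0) : IsUnit (diagSndBlock T₀ γ) := by
  rw [← Matrix.mulVec_injective_iff_isUnit]
  refine (injective_iff_map_eq_zero (diagSndBlock T₀ γ).mulVecLin).2 fun c hc => ?_
  rw [Matrix.mulVecLin_apply] at hc
  have h1 : γ.1 *ᵥ Sum.elim (diagDarbouxFst *ᵥ c) (diagDarbouxSnd T₀ *ᵥ c) = 0 := by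
    rw [symplectic_mulVec_diagDarboux, hP, hc, Matrix.zero_mulVec]
    funext i; rcases i with i | i <;> rfl
  have h2 : Sum.elim ((diagDarbouxFst : Matrix (ι ⊕ ι) (ι ⊕ ι) F) *ᵥ c) (diagDarbouxSnd T₀ *ᵥ c) = 0 :=
    Matrix.mulVec_injective_iff_isUnit.2 (isUnit_coe_symplecticGroup γ) (h1.trans (Matrix.mulVec_zero _).symm)
  rw [diagDarbouxFst_mulVec, diagDarbouxSnd_mulVec] at h2
  have h3 : c ∘ Sum.inl = 0 := by
    funext j; simpa using congr_fun h2 (Sum.inl (Sum.inl j))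
  have h4 : T₀ *ᵥ (c ∘ Sum.inr) = 0 := by
    funext j; simpa using congr_fun h2 (Sum.inr (Sum.inl j))
  have h5 : c ∘ Sum.inr = 0 :=
    Matrix.mulVec_injective_iff_isUnit.2 hT₀ (h4.trans (Matrix.mulVec_zero _).symm)
  rw [← Sum.elim_comp_inl_inr c, h3, h5]
  funext i; rcases i with i | i <;> rfl

/-- **`γ(W^Δ) ⊆ 𝕐` ⇒ rational parametrisation.** If `r(γ)` carries every point `((a,a),(b,b))` of `W^Δ(𝔸)` into
`𝕐 = {0} × 𝔸^{ι⊕ι}`, then there is `A₀ ∈ GL_{ι⊕ι}(F)` (namely `Q₀⁻¹ (T₀ ⊕ (-T₀))`) with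
`r(γ) (diag ((A₀ ⊗ 1) y)) = (0, y)` for all `y ∈ 𝔸^{ι⊕ι}` — so `r(γ) : W^Δ(𝔸) → 𝕐(𝔸)` is onto, with a rational
inverse. [folklore] -/
theorem exists_ratParam_of_fst_ratSpι_diag_eq_zero (T₀ : Matrix ι ι F) (hT₀ : IsUnit T₀)
    (hT : IsUnit (doubledGram (T₀.map (algebraMap F (AdeleRing (𝓞 F) F)))).det) (γ : Matrix.symplecticGroup (ι ⊕ ι) F)
    (hγ : ∀ a b : ι → AdeleRing (𝓞 F) F,
      ((ratSpι F (ι ⊕ ι) (doubledGram (T₀.map (algebraMap F (AdeleRing (𝓞 F) F)))) hT γ :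
        ((ι ⊕ ι → AdeleRing (𝓞 F) F) × (ι ⊕ ι → AdeleRing (𝓞 F) F)) ≃ₗ[AdeleRing (𝓞 F) F] ((ι ⊕ ι → AdeleRing (𝓞 F) F) × (ι ⊕ ι → AdeleRing (𝓞 F) F))) (Sum.elim a a, Sum.elim b b)).1 = 0) :
    ∃ A₀ : Matrix (ι ⊕ ι) (ι ⊕ ι) F, IsUnit A₀ ∧ ∀ y : ι ⊕ ι → AdeleRing (𝓞 F) F,
      (ratSpι F (ι ⊕ ι) (doubledGram (T₀.map (algebraMap F (AdeleRing (𝓞 F) F)))) hT γ : _ ≃ₗ[AdeleRing (𝓞 F) F] _)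
          (diagLagrangianPt ((A₀.map (algebraMap F (AdeleRing (𝓞 F) F))) *ᵥ y)) = ((0 : ι ⊕ ι → AdeleRing (𝓞 F) F), y) := by
  have hP := diagFstBlock_eq_zero T₀ hT γ hγ
  have hQ := isUnit_diagSndBlock T₀ hT₀ γ hP
  have hQdet := (Matrix.isUnit_iff_isUnit_det _).1 hQ
  refine ⟨(diagSndBlock T₀ γ)⁻¹ * Matrix.fromBlocks T₀ 0 0 (-T₀), ?_, fun y => ?_⟩
  · exact (Matrix.isUnit_nonsing_inv_iff.2 hQ).mul (isUnit_fromBlocks_neg T₀ hT₀)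
  · rw [ratSpι_diagLagrangianPt, hP, Matrix.map_zero _ (map_zero _), Matrix.zero_mulVec]
    refine Prod.ext rfl ?_
    have h1 : (diagSndBlock T₀ γ).map (algebraMap F (AdeleRing (𝓞 F) F)) *ᵥ
        (((diagSndBlock T₀ γ)⁻¹ * Matrix.fromBlocks T₀ 0 0 (-T₀)).map (algebraMap F (AdeleRing (𝓞 F) F)) *ᵥ y) =
          doubledGram (T₀.map (algebraMap F (AdeleRing (𝓞 F) F))) *ᵥ y := by
      rw [Matrix.mulVec_mulVec, ← Matrix.map_mul, ← Matrix.mul_assoc, Matrix.mul_nonsing_inv _ hQdet,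
        Matrix.one_mul, Matrix.fromBlocks_map, Matrix.map_zero _ (map_zero _), Matrix.map_neg _ (map_neg _)]
    change (doubledGram (T₀.map (algebraMap F (AdeleRing (𝓞 F) F))))⁻¹ *ᵥ ((diagSndBlock T₀ γ).map (algebraMap F (AdeleRing (𝓞 F) F)) *ᵥ
        (((diagSndBlock T₀ γ)⁻¹ * Matrix.fromBlocks T₀ 0 0 (-T₀)).map (algebraMap F (AdeleRing (𝓞 F) F)) *ᵥ y)) = y
    rw [h1, Matrix.mulVec_mulVec, Matrix.nonsing_inv_mul _ hT, Matrix.one_mulVec]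

end Lagrangian

section Kernel

variable {F : Type} [Field F] [NumberField F] {ι : Type} [Fintype ι] [DecidableEq ι]

/-- `det (T ⊕ (-T))` is a unit for `T = T₀ ⊗ 1`, `T₀ ∈ GL_ι(F)` (the hypothesis shape of `ratSpι`). [folklore] -/
theorem isUnit_det_doubledGram (T₀ : Matrix ι ι F) (hT₀ : IsUnit T₀) :
    IsUnit (doubledGram (T₀.map (algebraMap F (AdeleRing (𝓞 F) F)))).det := by
  rw [← Matrix.isUnit_iff_isUnit_det, doubledGram_map]
  exact (isUnit_fromBlocks_neg T₀ hT₀).map (RingHom.mapMatrix (algebraMap F (AdeleRing (𝓞 F) F)))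

variable [MeasurableSpace (AdeleRing (𝓞 F) F)] [BorelSpace (AdeleRing (𝓞 F) F)] (ν : Measure (ι → (AdeleRing (𝓞 F) F))) [ν.IsAddHaarMeasure]

/-- **Kernel item (b) for Weil's `r_F(γ)`.** For `γ ∈ Sp_{2(ι⊕ι)}(F)` carrying the diagonal Lagrangian onto
`𝕐` through a rational parametrisation `A₀`, `ν(D^ι) · (ω(r_F γ) Ψ)(0) = ∫ Ψ(u,u) dν`.
(`r_F` = `ratThetaLiftContι`, [cite: Weil1964, Chap. III n° 41 Thm 6 p. 193]; the evaluation is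
[cite: Li1992, (13) pp. 181–182], [cite: HarrisKudlaSweet1996, (1.16) p. 952], there with Tamagawa measure.) -/
theorem measure_mul_omega_ratThetaLiftContι_apply_zero (T₀ : Matrix ι ι F) (hT₀ : IsUnit T₀)
    (hT : IsUnit (doubledGram (T₀.map (algebraMap F (AdeleRing (𝓞 F) F)))).det)
    (A₀ : Matrix (ι ⊕ ι) (ι ⊕ ι) F) (hA₀ : IsUnit A₀) (γ : Matrix.symplecticGroup (ι ⊕ ι) F)
    (hW : ∀ y : ι ⊕ ι → (AdeleRing (𝓞 F) F),
      (ratSpι F (ι ⊕ ι) (doubledGram (T₀.map (algebraMap F (AdeleRing (𝓞 F) F)))) hT γ : _ ≃ₗ[(AdeleRing (𝓞 F)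
          F)] _) (diagLagrangianPt (A₀.map (algebraMap F (AdeleRing (𝓞 F) F)) *ᵥ y)) =
        ((0 : ι ⊕ ι → (AdeleRing (𝓞 F) F)), y))
    (Ψ : piSchwartzBruhat F (ι ⊕ ι)) :
    ((ν (piFundamentalDomain F ι)).toReal : ℂ) *
        ((adelicMpCont.omega F (ι ⊕ ι) (doubledGram (T₀.map (algebraMap F (AdeleRing (𝓞 F) F))))
            (ratThetaLiftContι F (ι ⊕ ι) (doubledGram (T₀.map (algebraMap F (AdeleRing (𝓞 F) F)))) hT γ) Ψ :
          piSchwartzBruhat F (ι ⊕ ι)) : (ι ⊕ ι → (AdeleRing (𝓞 F) F)) → ℂ) 0 =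
      ∫ u, (Ψ : (ι ⊕ ι → (AdeleRing (𝓞 F) F)) → ℂ) (Sum.elim u u) ∂ν := by
  have h := measure_mul_toOp_apply_zero_eq_integral_diag ν T₀ hT₀ A₀ hA₀
    (ratThetaLiftContι F (ι ⊕ ι) (doubledGram (T₀.map (algebraMap F (AdeleRing (𝓞 F) F)))) hT γ : adelicMp F (ι
        ⊕ ι) (doubledGram (T₀.map (algebraMap F (AdeleRing (𝓞 F) F)))))
    (coe_ratThetaLiftContι_mem_adelicMpTheta F (ι ⊕ ι) (doubledGram (T₀.map (algebraMap F (AdeleRing (𝓞 F) F)))) hT γ)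
    (by rw [proj_coe_ratThetaLiftContι]; exact hW) Ψ
  simpa only [adelicMpCont.omega_apply, omegaPsi_apply, MpPsi.toOp_apply] using h

/-- **Kernel item (b), Tamagawa normalisation `ν(D^ι) = 1`: `(ω(r_F γ) Ψ)(0) = ∫ Ψ(u,u) dν`, `c = 1`.**
[cite: Li1992, (13) pp. 181–182] [cite: HarrisKudlaSweet1996, (1.16) p. 952] [cite: Weil1964, Chap. III n° 41 Thm 6 p. 193] -/
theorem omega_ratThetaLiftContι_apply_zero (T₀ : Matrix ι ι F) (hT₀ : IsUnit T₀)
    (hT : IsUnit (doubledGram (T₀.map (algebraMap F (AdeleRing (𝓞 F) F)))).det)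
    (A₀ : Matrix (ι ⊕ ι) (ι ⊕ ι) F) (hA₀ : IsUnit A₀) (γ : Matrix.symplecticGroup (ι ⊕ ι) F)
    (hW : ∀ y : ι ⊕ ι → (AdeleRing (𝓞 F) F),
      (ratSpι F (ι ⊕ ι) (doubledGram (T₀.map (algebraMap F (AdeleRing (𝓞 F) F)))) hT γ : _ ≃ₗ[(AdeleRing (𝓞 F)
          F)] _) (diagLagrangianPt (A₀.map (algebraMap F (AdeleRing (𝓞 F) F)) *ᵥ y)) =
        ((0 : ι ⊕ ι → (AdeleRing (𝓞 F) F)), y))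
    (hν : ν (piFundamentalDomain F ι) = 1) (Ψ : piSchwartzBruhat F (ι ⊕ ι)) :
    ((adelicMpCont.omega F (ι ⊕ ι) (doubledGram (T₀.map (algebraMap F (AdeleRing (𝓞 F) F)))) (ratThetaLiftContι
        F (ι ⊕ ι) (doubledGram (T₀.map (algebraMap F (AdeleRing (𝓞 F) F)))) hT γ) Ψ :
        piSchwartzBruhat F (ι ⊕ ι)) : (ι ⊕ ι → (AdeleRing (𝓞 F) F)) → ℂ) 0 =
      ∫ u, (Ψ : (ι ⊕ ι → (AdeleRing (𝓞 F) F)) → ℂ) (Sum.elim u u) ∂ν := by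
  have h1 : ((ν (piFundamentalDomain F ι)).toReal : ℂ) = 1 := by
    rw [hν, ENNReal.toReal_one, Complex.ofReal_one]
  simpa only [h1, one_mul] using measure_mul_omega_ratThetaLiftContι_apply_zero ν T₀ hT₀ hT A₀ hA₀ γ hW Ψ

/-- **Kernel item (b), box form: `(ω(r_F γ)(φ₁ ⊠ φ₂))(0) = ∫ φ₁ φ₂ dν = ⟨φ₁, φ̄₂⟩`, `c = 1`.**
[cite: Li1992, (13) pp. 181–182] [cite: HarrisKudlaSweet1996, (1.16) p. 952] -/
theorem omega_ratThetaLiftContι_tensorToSum_apply_zero (T₀ : Matrix ι ι F) (hT₀ : IsUnit T₀)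
    (hT : IsUnit (doubledGram (T₀.map (algebraMap F (AdeleRing (𝓞 F) F)))).det)
    (A₀ : Matrix (ι ⊕ ι) (ι ⊕ ι) F) (hA₀ : IsUnit A₀) (γ : Matrix.symplecticGroup (ι ⊕ ι) F)
    (hW : ∀ y : ι ⊕ ι → (AdeleRing (𝓞 F) F),
      (ratSpι F (ι ⊕ ι) (doubledGram (T₀.map (algebraMap F (AdeleRing (𝓞 F) F)))) hT γ : _ ≃ₗ[(AdeleRing (𝓞 F)
          F)] _) (diagLagrangianPt (A₀.map (algebraMap F (AdeleRing (𝓞 F) F)) *ᵥ y)) =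
        ((0 : ι ⊕ ι → (AdeleRing (𝓞 F) F)), y))
    (hν : ν (piFundamentalDomain F ι) = 1) (φ₁ φ₂ : piSchwartzBruhat F ι) :
    ((adelicMpCont.omega F (ι ⊕ ι) (doubledGram (T₀.map (algebraMap F (AdeleRing (𝓞 F) F)))) (ratThetaLiftContι
        F (ι ⊕ ι) (doubledGram (T₀.map (algebraMap F (AdeleRing (𝓞 F) F)))) hT γ) (tensorToSum F ι ι φ₁ φ₂) :
        piSchwartzBruhat F (ι ⊕ ι)) : (ι ⊕ ι → (AdeleRing (𝓞 F) F)) → ℂ) 0 =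
      ∫ u, (φ₁ : (ι → (AdeleRing (𝓞 F) F)) → ℂ) u * (φ₂ : (ι → (AdeleRing (𝓞 F) F)) → ℂ) u ∂ν := by
  rw [omega_ratThetaLiftContι_apply_zero ν T₀ hT₀ hT A₀ hA₀ γ hW hν]
  rfl

/-- **Kernel item (b) in the `⊆`-form.** If `r_F(γ)` carries the diagonal Lagrangian `W^Δ(𝔸) = {((a,a),(b,b))}`
into `𝕐 = {0} × 𝔸^{ι⊕ι}` (the hypothesis on `δ` in [cite: Li1992, p. 181]: `𝕎 = 𝕏 + 𝕐`, `δ(W^Δ) = 𝕐`;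
`⊆` already forces `=`, §8), then `ν(D^ι) · (ω(r_F γ) Ψ)(0) = ∫ Ψ(u,u) dν`. [cite: Li1992, (13) pp. 181–182]
[cite: HarrisKudlaSweet1996, (1.16) p. 952] -/
theorem measure_mul_omega_ratThetaLiftContι_apply_zero_of_subset (T₀ : Matrix ι ι F) (hT₀ : IsUnit T₀)
    (hT : IsUnit (doubledGram (T₀.map (algebraMap F (AdeleRing (𝓞 F) F)))).det) (γ : Matrix.symplecticGroup (ι ⊕ ι) F)
    (hγ : ∀ a b : ι → AdeleRing (𝓞 F) F,
      ((ratSpι F (ι ⊕ ι) (doubledGram (T₀.map (algebraMap F (AdeleRing (𝓞 F) F)))) hT γ :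
        ((ι ⊕ ι → AdeleRing (𝓞 F) F) × (ι ⊕ ι → AdeleRing (𝓞 F) F)) ≃ₗ[AdeleRing (𝓞 F) F] ((ι ⊕ ι → AdeleRing (𝓞 F) F) × (ι ⊕ ι → AdeleRing (𝓞 F) F))) (Sum.elim a a, Sum.elim b b)).1 = 0)
    (Ψ : piSchwartzBruhat F (ι ⊕ ι)) :
    ((ν (piFundamentalDomain F ι)).toReal : ℂ) *
        ((adelicMpCont.omega F (ι ⊕ ι) (doubledGram (T₀.map (algebraMap F (AdeleRing (𝓞 F) F)))) (ratThetaLiftContι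
          F (ι ⊕ ι) (doubledGram (T₀.map (algebraMap F (AdeleRing (𝓞 F) F)))) hT γ) Ψ :
          piSchwartzBruhat F (ι ⊕ ι)) : (ι ⊕ ι → (AdeleRing (𝓞 F) F)) → ℂ) 0 =
      ∫ u, (Ψ : (ι ⊕ ι → (AdeleRing (𝓞 F) F)) → ℂ) (Sum.elim u u) ∂ν := by
  have hex := exists_ratParam_of_fst_ratSpι_diag_eq_zero T₀ hT₀ hT γ hγ
  obtain ⟨A₀, hA₀, hW⟩ := hex
  have h := measure_mul_omega_ratThetaLiftContι_apply_zero ν T₀ hT₀ hT A₀ hA₀ γ hW Ψ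
  exact h

/-- **Kernel item (b) in the `⊆`-form, Tamagawa normalisation: `(ω(r_F γ) Ψ)(0) = ∫_{𝔸^ι} Ψ(u,u) dν(u)` for every
`γ ∈ Sp(F)` with `r_F(γ)(W^Δ) ⊆ 𝕐`.** [cite: Li1992, (13) pp. 181–182] [cite: HarrisKudlaSweet1996, (1.16) p. 952] -/
theorem omega_ratThetaLiftContι_apply_zero_of_subset (T₀ : Matrix ι ι F) (hT₀ : IsUnit T₀)
    (hT : IsUnit (doubledGram (T₀.map (algebraMap F (AdeleRing (𝓞 F) F)))).det) (γ : Matrix.symplecticGroup (ι ⊕ ι) F)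
    (hγ : ∀ a b : ι → AdeleRing (𝓞 F) F,
      ((ratSpι F (ι ⊕ ι) (doubledGram (T₀.map (algebraMap F (AdeleRing (𝓞 F) F)))) hT γ :
        ((ι ⊕ ι → AdeleRing (𝓞 F) F) × (ι ⊕ ι → AdeleRing (𝓞 F) F)) ≃ₗ[AdeleRing (𝓞 F) F] ((ι ⊕ ι → AdeleRing (𝓞 F) F) × (ι ⊕ ι → AdeleRing (𝓞 F) F))) (Sum.elim a a, Sum.elim b b)).1 = 0)
    (hν : ν (piFundamentalDomain F ι) = 1) (Ψ : piSchwartzBruhat F (ι ⊕ ι)) :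
    ((adelicMpCont.omega F (ι ⊕ ι) (doubledGram (T₀.map (algebraMap F (AdeleRing (𝓞 F) F)))) (ratThetaLiftContι
        F (ι ⊕ ι) (doubledGram (T₀.map (algebraMap F (AdeleRing (𝓞 F) F)))) hT γ) Ψ :
        piSchwartzBruhat F (ι ⊕ ι)) : (ι ⊕ ι → (AdeleRing (𝓞 F) F)) → ℂ) 0 =
      ∫ u, (Ψ : (ι ⊕ ι → (AdeleRing (𝓞 F) F)) → ℂ) (Sum.elim u u) ∂ν := by
  have hex := exists_ratParam_of_fst_ratSpι_diag_eq_zero T₀ hT₀ hT γ hγ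
  obtain ⟨A₀, hA₀, hW⟩ := hex
  have h := omega_ratThetaLiftContι_apply_zero ν T₀ hT₀ hT A₀ hA₀ γ hW hν Ψ
  exact h

/-- **Kernel item (b), box form in the `⊆`-form: `(ω(r_F γ)(φ₁ ⊠ φ₂))(0) = ∫ φ₁ φ₂ dν`, `c = 1`, for every
`γ ∈ Sp(F)` with `r_F(γ)(W^Δ) ⊆ 𝕐`** — the statement typed as `KernelItemB` in the sprint (with `φ₂ ↦ φ̄₂` it is
`⟨φ₁, φ₂⟩`). [cite: Li1992, (13) pp. 181–182] [cite: HarrisKudlaSweet1996, (1.16) p. 952] -/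
theorem omega_ratThetaLiftContι_tensorToSum_apply_zero_of_subset (T₀ : Matrix ι ι F) (hT₀ : IsUnit T₀)
    (hT : IsUnit (doubledGram (T₀.map (algebraMap F (AdeleRing (𝓞 F) F)))).det) (γ : Matrix.symplecticGroup (ι ⊕ ι) F)
    (hγ : ∀ a b : ι → AdeleRing (𝓞 F) F,
      ((ratSpι F (ι ⊕ ι) (doubledGram (T₀.map (algebraMap F (AdeleRing (𝓞 F) F)))) hT γ :
        ((ι ⊕ ι → AdeleRing (𝓞 F) F) × (ι ⊕ ι → AdeleRing (𝓞 F) F)) ≃ₗ[AdeleRing (𝓞 F) F] ((ι ⊕ ι → AdeleRing (𝓞 F) F) × (ι ⊕ ι → AdeleRing (𝓞 F) F))) (Sum.elim a a, Sum.elim b b)).1 = 0)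
    (hν : ν (piFundamentalDomain F ι) = 1) (φ₁ φ₂ : piSchwartzBruhat F ι) :
    ((adelicMpCont.omega F (ι ⊕ ι) (doubledGram (T₀.map (algebraMap F (AdeleRing (𝓞 F) F)))) (ratThetaLiftContι
        F (ι ⊕ ι) (doubledGram (T₀.map (algebraMap F (AdeleRing (𝓞 F) F)))) hT γ) (tensorToSum F ι ι φ₁ φ₂) :
        piSchwartzBruhat F (ι ⊕ ι)) : (ι ⊕ ι → (AdeleRing (𝓞 F) F)) → ℂ) 0 =
      ∫ u, (φ₁ : (ι → (AdeleRing (𝓞 F) F)) → ℂ) u * (φ₂ : (ι → (AdeleRing (𝓞 F) F)) → ℂ) u ∂ν := by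
  have hex := exists_ratParam_of_fst_ratSpι_diag_eq_zero T₀ hT₀ hT γ hγ
  obtain ⟨A₀, hA₀, hW⟩ := hex
  have h := omega_ratThetaLiftContι_tensorToSum_apply_zero ν T₀ hT₀ hT A₀ hA₀ γ hW hν φ₁ φ₂
  exact h

end Kernel

end Literature.NumberTheory.Weil1964
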